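import Mathlib
import Literature.MathematicalPhysics.QuantumFieldTheory.Balaban1983to89.B6Prop23Printed

/-!
# `Balaban1983to89.B6Prop27Kernel` — p. 249: Proposition 2.7 (the inverse of QGQ*, (2.149)) BY ITS PRINTED PROOF — the
(2.82)–(2.87) chain of Proposition 2.3 re-run *"with powers of scaling factors changed properly (we replace +4 and −4 in
(2.83) by +2 and −2)"*, kernel-checked ONCE at a general scaling power p (p = 4: Proposition 2.3, the landed
`…B6Prop23Assembled` ∕ `…B6Prop23Printed`; p = 2: Proposition 2.7) and joined to the census declaration `B6.Prop27Printed`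
(B6 = T. Bałaban, *Propagators and renormalization transformations for lattice gauge theories. II*, Commun. Math.
Phys. **96**, 223–250 (1984) [Balaban1984PropagatorsII]).

CITATION HEADER (lean-in-tree rule 2026-08-18).  Cell `pub-balaban`, unit `b2b-balaban-b06-g16` (paper sub-cell B06,
gen 16 — the owner lineage of `…B6`, `…B6RandomWalk`, `…B6Ineq268`, `…B6Ineq283`, `…B6Expansion282`, `…B6Line4Member12`,
`…B6Prop23Chain`, `…B6Prop23Assembled`, `…B6Prop23Printed`).  Source: doi:10.1007/bf01240221, held
`paper:balaban1984-cmp96-propagators-rt-ii`; journal page = PDF page + 222; the quotations below were read from the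
page renders `b2b-balaban-ref1/pages/1984-cmp96-propagators-rt-II/1984-cmp96-propagators-rt-II-p026-x2.png` (p. 248)
and `…-p027-x2.png` (p. 249) AS IMAGES (the (2.82)–(2.87) quotations of pp. 237–238 are those of the imported siblings,
renders `…-p015-x2.png`, `…-p016-x2.png`).  Kernel twin of the hand certification GAPS C-adv4-38 (unit
b2b-balaban-adv4-g13: the substitution table of the «by analogy» proof of Proposition 2.7 with its two implicit
conditions «e^{¼δ₃RM} ≥ L²» and the rate split) and of the census node CENSUS-B6-v1 §7 O-12 (unit b2b-balaban-b06-g15: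
«Prop. 2.7 — P, by analogy; kernel target = re-instantiate the Prop. 2.3 chain at powers ±2»); cell rows GAPS
C-b06g16-1, DIVERGENCE D-b06.35; journal claim PROP27-KERNEL.

THE PRINTED TEXT.  p. 248 [PDF 26], verbatim: *"Finally let us consider the operator QGQ* and its inverse. We consider
these operators on the L²-space defined by (2.69) with sites replaced by bonds. The operator QGQ* is positive, hence the
inverse is well defined and positive also. We want to prove similar bounds as for the operator Q′G′²Q′* and we will
follow rather closely the arguments given for it. From (2.136) we have
|(QGQ*)(b, b′)| ≤ O(1)(L^jη)²(L^{j′}η)^{−d}e^{−δ₃d(b,b′)}, b ∈ Λ_j, b′ ∈ Λ_{j′}. (2.142)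
Keeping the same notations as before we consider the operators C_□ = ((QG_□Q*)↾_□)⁻¹, C = Σ_{□∈𝒟} h_□C_□h_□. (2.143)"*
… *"⟨B, (QG_□Q*)↾_□B⟩ ≥ γ₀‖B‖² (2.147) with a positive constant γ₀ depending on d and L only. Of course we have also a
similar bound from above and an exponential decay of a kernel of the operator in (2.147). This implies the same
properties for C_□^ξ with the corresponding bounds"*; p. 249 [PDF 27], verbatim: *"and a decay rate δ₄. For the operator
C_□ we get |C_□(b, b′)| ≤ O(1)(L^jη)^{−d−2}e^{−δ₄(L^jη)^{−1}|b₋−b′₋|}, b, b′ ∈ 𝔅∩□. (2.148)  We form the equality for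
QGQ*C in exactly the same way as in (2.82) replacing only in the definition of R_{□,□′} the operators Q′, G′(□̃)², G′²
by Q, G_□, G. We have the same estimates now as before, but with powers of scaling factors changed properly (we replace
+4 and −4 in (2.83) by +2 and −2), thus we have (2.85) and this implies Proposition 2.7. The operator (QGQ*)⁻¹ is given
by the convergent expansions of the form (2.86), and it satisfies the bound
|(QGQ*)⁻¹(b, b′)| ≤ O(1)(L^jη)^{−2}(L^{j′}η)^{−d}e^{−½δ₄d(b,b′)}, b ∈ Λ_j, b′ ∈ Λ_{j′}. (2.149)"* (= Proposition 2.7 =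
the census declaration `B6.Prop27Printed`, typed verbatim in `…B6`).

THE TYPING (as in the siblings, with the scaling power a parameter p : ℕ).  Carrier 𝔅 = `g.Site` (for Prop. 2.7 the
bonds of 𝔅, «sites replaced by bonds» — `B6.Geometry` does not distinguish), weights w(y′) = (L^{j′}η)^d of (2.69),
operators as matrices through `B6Prop23Chain.mat`, kernels K_w(X) (`B6Expansion282.kerOp`); X = the kernel of QGQ*
(p = 2) resp. Q′G′²Q′* (p = 4) with the majorant |w(y″)X(y, y″)| ≤ B_X(L^jη)^p e^{−½δ₀d(y,y″)} — (2.142) for p = 2 with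
δ₀ := 2δ₃ a FREE RATE NAME in this module (not the δ₀ of (2.17)), (2.68) for p = 4; X̃_□ = QG_□Q* resp. Q′G′(□̃)²Q′* with
the same majorant, and the change-of-domain majorant B_D e^{−c₃M}(L^jη)^p e^{−½δ₀d} of □(X̃_□ − X)h_□; C_□ with
|C_□(y″, y′)| ≤ B_C(L^{j_□}η)^{−d−p}e^{−δ₁d(y″,y′)} on □ × □ — (2.148) for p = 2 (δ₁ := δ₄; inside one cube the straight
contour (L^jη)^{−1}|b₋ − b′₋| is admissible in (2.46), so the d-form is the weaker hypothesis; j_□ ∈ {j, j−1}, one factor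
L absorbed in B_C), (2.81) for p = 4; the located cover facts of pp. 229–235 (□ ∈ {0,1}, □h_□ = h_□, Σ_□h_□² = 1,
|h_□(y) − h_□(y″)| ≤ (s/M)d(y,y″), overlap number n₀, cube scales {j_□, j_□+1}, single-level supports, the gap m_g·M
between □ᶜ and supp h_□, C_□(y″, ·) = 0 off □) and the (2.70)-type identity (□X̃_□□)C_□h_□ = h_□ ((2.143): C_□ =
((QG_□Q*)↾_□)⁻¹); the geometry (2.54) `Triangle254`, (2.60) `LevelSep`, (2.61)∕(2.63) `Ineq261With`∕`Ineq263With`.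
The scale weight of (2.83) at power p is `ratioP g p y y′` = L^{p(j−j′)} (`ratioP_four` = `B6Ineq283.ratio4`,
`ratioP_two` = `B6Ineq268.ratio` with swapped arguments), members 2–5 of (2.83) at power p are `line283P_2…5`
(`line283P_k_four` = `B6Ineq283.line283_k`), the (2.85) constants are `kappa2P∕3P∕4P`, `theta285P`, `K285P` (`…_four` =
the constants of `…B6Prop23Assembled`, by `rfl`).  RATE CONVENTIONS for p = 2 in the printed letters (½δ₀ = δ₃,
δ₁ = δ₄): the p-independent split δ₁ + σδ₀ ≤ ¼δ₀ reads δ₄ + 2σδ₃ ≤ ½δ₃ (C-adv4-38 displays the sufficient δ₄ ≤ ¼δ₃), and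
the scale threshold L^p ≤ e^{⅛δ₀RM} reads L² ≤ e^{¼δ₃RM} — literally the implicit condition 1 of C-adv4-38.

WHAT THIS MODULE PROVES (kernel-checked; no `sorry`, no axiom beyond Lean's three; every analytic input is a hypothesis
with free constants, every O(·) an explicit function of them):
1. §1–§2 THE POWER BOOKKEEPING, once for all p: `scale_bookkeeping_pow` (a^d∕b^{d+p} ≤ L^{d+p}∕e^p), `len_pow_le`
   ((L^jη)^p ≤ L^p(L^{j′}η)^p inside one cube), `ratioP_mul_exp_le` (THE WEIGHT ABSORPTION L^{p(j−j′)}e^{−β max{|j−j′|−1,0}}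
   ≤ L^p as soon as L^p ≤ e^β), and the printed chain of (2.83) «with +4 and −4 replaced by +p and −p»:
   `line2P_le_line3P` (the single-scale sum, whose ratio-free core `supportSum_le` is `B6Ineq283.line2_le_line3` with
   its spectator weight divided out — the split δ₁ + σδ₀ ≤ ¼δ₀ is p-INDEPENDENT), `line3P_le_line4P` (gap + (2.60)),
   `line4P_le_line5P` (uniform in the number of scales as soon as L^p ≤ e^{⅛δ₀RM}, i.e. 8p·log L ≤ δ₀RM; necessity at
   p = 2, 4 is `B6Ineq268.line4_not_uniform` ∕ `B6Ineq283.line4_not_uniform`), `line2P_le_line5P`.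
2. §3–§5 THE THREE FAMILIES OF THE (2.82)-TYPE EQUALITY AT POWER p in the (2.85) shape ε·e^{−δ₁d(y,y′)}:
   `line4Ker_abs_le_pow` (member 1 ⇒ 2, DERIVED from the p = 4 theorem `B6Line4Member12.line4Ker_abs_le` by
   reparametrising its free constants — the powers are spectators of the y″-sum), `line4Ker_abs_le_285_pow`,
   `ck_weighted_le_pow` + `mat_Cglued_abs_le_pow` (|mat C| ≤ n₀B_C L^{d+p}(L^jη)^{−p}e^{−δ₁d}), `commPiece_abs_le_pow`
   (O(M⁻¹), from the exponent-free `B6Expansion282.line2Ker_abs_le`), `domPiece_abs_le_pow` (e^{−c₃M}),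
   `offPiece_abs_le_pow` (e^{−⅛δ₀m_gM}).
3. §6 THE ASSEMBLY AT POWER p: `mat_diag_abs_le_pow`, `mat_off_abs_le_pow`, `mat_R_abs_le_pow` ((2.85): |mat R| ≤
   θ_p e^{−δ₁d}, θ_p = `theta285P` ≤ `K285P`∕M by `theta285P_le`), `kernel_bound_pow` + `inverse_kernel_pow` ((2.86)–(2.87)
   at power p from `B6Prop23Chain.prop23_matrix` with P(y) = (L^jη)^{−p}), and `inverse_assembled_pow`: under the
   hypothesis package above, L^p ≤ e^{⅛δ₀RM} and M ≥ 2K_pc, X has a unique two-sided inverse G = C + GR with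
   |G(y, y′)| ≤ 2n₀B_C L^{d+p}c·(L^jη)^{−p}(L^{j′}η)^{−d}e^{−½δ₁d(y,y′)} — at p = 4 the hypotheses and constants are
   literally those of `B6Prop23Assembled.prop23_assembled` (`K285P_four`), at p = 2 they are the printed substitutions.
4. §7 THE EDGE p = 2, `prop27Printed_of_assembled`: for a family of situations with uniform constants, a common
   threshold M₁ («for M large enough») and the dictionary "`Qinv i` is the (2.69)-kernel of an inverse of QGQ*", the
   census declaration `B6.Prop27Printed d geo Qinv` — *"|(QGQ*)⁻¹(b,b′)| ≤ O(1)(L^jη)^{−2}(L^{j′}η)^{−d}e^{−½δ₄d(b,b′)}"* —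
   holds with witnesses (M₁, δ₄, C = 2n₀B_C L^{d+2}c); §8 `prop27Printed_pt`: every hypothesis of the edge is
   discharged on the one-point family `B6Prop23Assembled.ptGeo` (the hypothesis package is consistent).
WHAT IT DOES NOT PROVE: the inputs — (2.142) (from Prop. 2.6 (2.136)), (2.148) (from (2.144)–(2.147): the lower bound
γ₀(d, L) of (QG_□Q*)↾_□ via the B4 Sect. 5 theorem and «a similar bound from above and an exponential decay», GAPS
G-B6-12, C-adv4-37), the change-of-domain majorant for Q(G_□ − G)Q* with its factor e^{−c₃M}, the Lipschitz bound of h_□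
and the cover facts (all hypotheses, as in the siblings, whose scope caveats are inherited verbatim: single-level
supports `hlev`, the gap typed with a free m_g — G-adv4-14 —, the degenerate model of §8 certifies consistency only);
the positivity of QGQ* («hence the inverse is well defined») is not used — the inverse comes from the Neumann series,
as printed in (2.86)∕(2.149) — and its uniqueness is proved, not assumed; Corollary 2.8 (`…B6Cor28`).  Relation to
`…QGQInverse` (cell pub-balaban, unit r1): that module inverts a QGQ*-type operator by a Combes–Thomas argument from a
coercivity hypothesis — a different mechanism with a different rate; the present module is the printed route.  Value =
kernel certificate that the «by analogy» proof of Proposition 2.7 is the p = 2 instance of ONE power-uniform argument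
whose p = 4 instance is the landed Proposition 2.3 chain, with the p-dependence of every threshold explicit
(8p·log L ≤ δ₀RM; K_p through L^{d+p}, L^p); bookkeeping at fixed lattice spacing, NOT summit progress.
-/

namespace Literature.MathematicalPhysics.QuantumFieldTheory.Balaban1983to89.B6Prop27Kernel

open Literature.MathematicalPhysics.QuantumFieldTheory.Balaban1983to89
open Finset B6RandomWalk B6Lemma21Repaired B6Expansion282 B6Ineq268 B6Ineq283 B6Prop23Chain B6Line4Member12
  B6Prop23Assembled B6Prop23Printed

/-! ## §1. Power bookkeeping at a general scaling power p (p = 4: Prop. 2.3; p = 2: Prop. 2.7) -/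

section ScaleFacts

variable {g : B6.Geometry}

/-- THE POWER BOOKKEEPING at power p: with a = L^{j′}η ≤ L·b, e = L^jη ≤ L·b (b = L^{j_□}η the scale of the cube),
a^d/b^{d+p} ≤ L^{d+p}/e^p (p = 4: `B6Prop23Chain.scale_bookkeeping`). [folklore] -/
theorem scale_bookkeeping_pow (d p : ℕ) {L b a e : ℝ} (hb : 0 < b) (ha0 : 0 ≤ a) (he0 : 0 < e) (ha : a ≤ L * b)
    (he : e ≤ L * b) : a ^ d / b ^ (d + p) ≤ L ^ (d + p) / e ^ p := by
  rw [div_le_div_iff₀ (pow_pos hb _) (pow_pos he0 _)]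
  calc a ^ d * e ^ p ≤ (L * b) ^ d * (L * b) ^ p :=
        mul_le_mul (pow_le_pow_left₀ ha0 ha d) (pow_le_pow_left₀ he0.le he p) (by positivity)
          (pow_nonneg (ha0.trans ha) _)
    _ = L ^ (d + p) * b ^ (d + p) := by ring

/-- INSIDE ONE CUBE THE SCALE WEIGHT IS ≤ L^p: for scales j ≤ j′ + 1, (L^jη)^p ≤ L^p (L^{j′}η)^p
(p = 4: `B6Expansion282.len_pow_four_le`). [cite: Balaban1984PropagatorsII, (2.70) p.235 + (2.149) p.249] -/
theorem len_pow_le (p : ℕ) (hL : 1 ≤ g.L) (hη : 0 ≤ g.eta) {y y' : g.Site} (hsc : g.scale y ≤ g.scale y' + 1) :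
    g.len y ^ p ≤ g.L ^ p * g.len y' ^ p := by
  have hle : g.len y ≤ g.L * g.len y' := len_le_of_scale_le hL hη hsc
  have hnn : 0 ≤ g.len y := mul_nonneg (pow_nonneg (zero_le_one.trans hL) _) hη
  calc g.len y ^ p ≤ (g.L * g.len y') ^ p := pow_le_pow_left₀ hnn hle p
    _ = g.L ^ p * g.len y' ^ p := mul_pow _ _ _

variable (g) in
/-- The scale weight of (2.83) at power p: (L^jη)^p(L^{j′}η)^{−p} = L^{p(j−j′)} (y ∈ Λ_j, y′ ∈ Λ_{j′}), natural-number
exponents (p = 4: `B6Ineq283.ratio4`; p = 2: `B6Ineq268.ratio` with its arguments swapped).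
[cite: Balaban1984PropagatorsII, (2.83) p.237 + «we replace +4 and −4 in (2.83) by +2 and −2» p.249] -/
noncomputable def ratioP (p : ℕ) (y y' : g.Site) : ℝ := g.L ^ (p * g.scale y) / g.L ^ (p * g.scale y')

/-- The scale weight is non-negative (L ≥ 0). [folklore] -/
theorem ratioP_nonneg (hL : 0 ≤ g.L) (p : ℕ) (y y' : g.Site) : 0 ≤ ratioP g p y y' := by
  unfold ratioP; positivity

/-- Bookkeeping: L^{p(j−j′)} = (L^jη)^p/(L^{j′}η)^p (L, η ≠ 0). [folklore] -/
theorem ratioP_eq_len (hη : g.eta ≠ 0) (p : ℕ) (y y' : g.Site) :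
    ratioP g p y y' = g.len y ^ p / g.len y' ^ p := by
  unfold ratioP B6.Geometry.len
  have h1 : g.eta ^ p ≠ 0 := pow_ne_zero _ hη
  have e1 : (g.L ^ g.scale y * g.eta) ^ p = g.L ^ (p * g.scale y) * g.eta ^ p := by
    rw [mul_pow, ← pow_mul, mul_comm (g.scale y) p]
  have e2 : (g.L ^ g.scale y' * g.eta) ^ p = g.L ^ (p * g.scale y') * g.eta ^ p := by
    rw [mul_pow, ← pow_mul, mul_comm (g.scale y') p]
  rw [e1, e2, mul_div_mul_right _ _ h1]

/-- DICTIONARY p = 4: the scale weight at power 4 is `B6Ineq283.ratio4`. [folklore] -/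
theorem ratioP_four (y y' : g.Site) : ratioP g 4 y y' = ratio4 g y y' := by
  unfold ratioP ratio4 ratio
  have e1 : g.L ^ (4 * g.scale y) = (g.L ^ (2 * g.scale y)) ^ 2 := by
    rw [← pow_mul]; congr 1; ring
  have e2 : g.L ^ (4 * g.scale y') = (g.L ^ (2 * g.scale y')) ^ 2 := by
    rw [← pow_mul]; congr 1; ring
  rw [e1, e2, div_pow]

/-- DICTIONARY p = 2: the scale weight at power 2 is the factor L^{2(j−j′)} of (2.68), `B6Ineq268.ratio g y′ y`. [folklore] -/
theorem ratioP_two (y y' : g.Site) : ratioP g 2 y y' = ratio g y' y := rfl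

/-- THE WEIGHT ABSORPTION at power p: if L ≥ 1, β ≥ 0 and L^p ≤ e^{β}, then L^{p(j−j′)} e^{−β max{|j−j′|−1,0}} ≤ L^p
for all levels j, j′ (for j ≤ j′ both factors are ≤ 1; for j = j′ + 1 + n it reads L^p(L^pe^{−β})ⁿ ≤ L^p) — the power-p
form of `B6Ineq268.ratio_mul_exp_le` (p = 2) and `B6Ineq283.ratio4_mul_exp_le` (p = 4). [folklore] -/
theorem ratioP_mul_exp_le (hL : 1 ≤ g.L) {β : ℝ} (hβ : 0 ≤ β) (p : ℕ) (hthr : g.L ^ p ≤ Real.exp β)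
    (y y' : g.Site) : ratioP g p y y' * Real.exp (-(β * mx g y y')) ≤ g.L ^ p := by
  have hL0 : 0 < g.L := lt_of_lt_of_le one_pos hL
  have hLp : 1 ≤ g.L ^ p := one_le_pow₀ hL
  rcases le_or_gt (g.scale y) (g.scale y') with hle | hlt
  · -- j ≤ j′ : the weight is ≤ 1 and the exponential factor ≤ 1
    have hr : ratioP g p y y' ≤ 1 := by
      unfold ratioP
      rw [div_le_one (pow_pos hL0 _)]
      exact pow_le_pow_right₀ hL (Nat.mul_le_mul_left p hle)
    have he : Real.exp (-(β * mx g y y')) ≤ 1 := by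
      rw [Real.exp_le_one_iff]
      have := mx_nonneg y y'
      nlinarith
    calc ratioP g p y y' * Real.exp (-(β * mx g y y')) ≤ 1 * 1 :=
          mul_le_mul hr he (Real.exp_nonneg _) zero_le_one
      _ ≤ g.L ^ p := by rw [one_mul]; exact hLp
  · -- j = j′ + 1 + n
    obtain ⟨n, hn⟩ := Nat.exists_eq_add_of_lt hlt
    have hn' : g.scale y = g.scale y' + 1 + n := by omega
    have hmx : mx g y y' = n := mx_eq_of_lt' hn'
    have hr : ratioP g p y y' = g.L ^ p * (g.L ^ p) ^ n := by
      unfold ratioP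
      rw [hn', div_eq_iff (pow_ne_zero _ hL0.ne'), ← pow_mul, ← pow_add, ← pow_add]
      congr 1
      ring
    rw [hmx, hr]
    have hpow : (g.L ^ p) ^ n ≤ Real.exp β ^ n := pow_le_pow_left₀ (by positivity) hthr n
    have hexp : Real.exp β ^ n * Real.exp (-(β * n)) = 1 := by
      rw [← Real.exp_nat_mul, ← Real.exp_add]
      simp [mul_comm]
    calc g.L ^ p * (g.L ^ p) ^ n * Real.exp (-(β * n))
        ≤ g.L ^ p * Real.exp β ^ n * Real.exp (-(β * n)) := by
          refine mul_le_mul_of_nonneg_right ?_ (Real.exp_nonneg _)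
          exact mul_le_mul_of_nonneg_left hpow (by positivity)
      _ = g.L ^ p := by rw [mul_assoc, hexp, mul_one]

end ScaleFacts

/-! ## §2. The members 2–5 of (2.83) at power p and the printed chain «with powers … changed properly» -/

section Carriers283

variable (g : B6.Geometry)

/-- (2.83) MEMBER 2 at power p (prefactor O(1)·c₁·(L^{j′}η)^{−d} taken out):
(L^jη)^p(L^{j′}η)^{−p} Σ_{y″∈S′} e^{−½δ₀d(y,y″)} e^{−δ₁ρ(y″)} (p = 4: `B6Ineq283.line283_2`).
[cite: Balaban1984PropagatorsII, (2.83) member 2 p.237 + p.249] -/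
noncomputable def line283P_2 (p : ℕ) (δ₀ δ₁ : ℝ) (S' : Finset g.Site) (ρ : g.Site → ℝ) (y y' : g.Site) : ℝ :=
  ratioP g p y y' * ∑ y'' ∈ S', Real.exp (-(1 / 2 * δ₀ * g.dist y y'')) * Real.exp (-(δ₁ * ρ y''))

/-- (2.83) MEMBER 3 at power p: (L^jη)^p(L^{j′}η)^{−p} e^{−¼δ₀D} e^{−δ₁d(y,y′)} (p = 4: `B6Ineq283.line283_3`).
[cite: Balaban1984PropagatorsII, (2.83) member 3 p.237 + p.249] -/
noncomputable def line283P_3 (p : ℕ) (δ₀ δ₁ D : ℝ) (y y' : g.Site) : ℝ :=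
  ratioP g p y y' * Real.exp (-(1 / 4 * δ₀ * D)) * Real.exp (-(δ₁ * g.dist y y'))

/-- (2.83) MEMBER 4 at power p: e^{−⅛δ₀Mg} L^{p(j−j′)} e^{−⅛δ₀RM max{|j−j′|−1,0}} e^{−δ₁d(y,y′)}
(p = 4: `B6Ineq283.line283_4`). [cite: Balaban1984PropagatorsII, (2.83) member 4 p.237 + p.249] -/
noncomputable def line283P_4 (p : ℕ) (δ₀ δ₁ Mg : ℝ) (y y' : g.Site) : ℝ :=
  Real.exp (-(1 / 8 * δ₀ * Mg)) * ratioP g p y y' * Real.exp (-(1 / 8 * δ₀ * g.R * g.M * mx g y y')) *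
    Real.exp (-(δ₁ * g.dist y y'))

/-- (2.83) MEMBER 5 at power p (the absorbed weight L^p explicit): L^p e^{−⅛δ₀Mg} e^{−δ₁d(y,y′)}
(p = 4: `B6Ineq283.line283_5`). [cite: Balaban1984PropagatorsII, (2.83) member 5 p.237 + p.249] -/
noncomputable def line283P_5 (p : ℕ) (δ₀ δ₁ Mg : ℝ) (y y' : g.Site) : ℝ :=
  g.L ^ p * Real.exp (-(1 / 8 * δ₀ * Mg)) * Real.exp (-(δ₁ * g.dist y y'))

variable {g}

/-- DICTIONARY p = 4, member 2. [folklore] -/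
theorem line283P_2_four (δ₀ δ₁ : ℝ) (S' : Finset g.Site) (ρ : g.Site → ℝ) (y y' : g.Site) :
    line283P_2 g 4 δ₀ δ₁ S' ρ y y' = line283_2 g δ₀ δ₁ S' ρ y y' := by
  unfold line283P_2 line283_2; rw [ratioP_four]

/-- DICTIONARY p = 4, member 3. [folklore] -/
theorem line283P_3_four (δ₀ δ₁ D : ℝ) (y y' : g.Site) :
    line283P_3 g 4 δ₀ δ₁ D y y' = line283_3 g δ₀ δ₁ D y y' := by
  unfold line283P_3 line283_3; rw [ratioP_four]

/-- DICTIONARY p = 4, member 4. [folklore] -/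
theorem line283P_4_four (δ₀ δ₁ Mg : ℝ) (y y' : g.Site) :
    line283P_4 g 4 δ₀ δ₁ Mg y y' = line283_4 g δ₀ δ₁ Mg y y' := by
  unfold line283P_4 line283_4; rw [ratioP_four]

/-- DICTIONARY p = 4, member 5. [folklore] -/
theorem line283P_5_four (δ₀ δ₁ Mg : ℝ) (y y' : g.Site) :
    line283P_5 g 4 δ₀ δ₁ Mg y y' = line283_5 g δ₀ δ₁ Mg y y' := rfl

/-- THE RATIO-FREE CORE OF MEMBER 2 ⇒ 3: Σ_{y″∈S′} e^{−½δ₀d(y,y″)} e^{−δ₁ρ(y″)} ≤ c·e^{−¼δ₀D}e^{−δ₁d(y,y′)} for every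
split δ₁ + σδ₀ ≤ ¼δ₀ with (2.61) at α = σ — `B6Ineq283.line2_le_line3` with its spectator weight (L^jη)⁴(L^{j′}η)^{−4} > 0
divided out (L > 0), so that the same single-scale sum serves every power p. [cite: Balaban1984PropagatorsII, (2.83) p.237] -/
theorem supportSum_le (htri : Triangle254 g) (hd : ∀ a b : g.Site, 0 ≤ g.dist a b) (hL : 0 < g.L)
    {δ₀ δ₁ σ c D : ℝ} (hδ₀ : 0 ≤ δ₀) (hδ₁ : 0 ≤ δ₁) (hsplit : δ₁ + σ * δ₀ ≤ δ₀ / 4)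
    (h261 : Ineq261With c g δ₀ σ) {S' : Finset g.Site} {ρ : g.Site → ℝ} {y y' : g.Site}
    (hρ : ∀ y'' ∈ S', g.dist y'' y' ≤ ρ y'') (hD : ∀ y'' ∈ S', D ≤ g.dist y y'') :
    ∑ y'' ∈ S', Real.exp (-(1 / 2 * δ₀ * g.dist y y'')) * Real.exp (-(δ₁ * ρ y'')) ≤
      c * (Real.exp (-(1 / 4 * δ₀ * D)) * Real.exp (-(δ₁ * g.dist y y'))) := by
  have h := line2_le_line3 htri hd hδ₀ hδ₁ hsplit h261 hρ hD
  have hr : 0 < ratio4 g y y' := by unfold ratio4 ratio; positivity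
  unfold line283_2 line283_3 at h
  have h' : ratio4 g y y' * ∑ y'' ∈ S', Real.exp (-(1 / 2 * δ₀ * g.dist y y'')) * Real.exp (-(δ₁ * ρ y'')) ≤
      ratio4 g y y' * (c * (Real.exp (-(1 / 4 * δ₀ * D)) * Real.exp (-(δ₁ * g.dist y y')))) :=
    h.trans_eq (by ring)
  exact le_of_mul_le_mul_left h' hr

/-- **MEMBER 2 ≤ c · MEMBER 3 at power p** (the scale weight is a spectator of the single-scale sum).
[cite: Balaban1984PropagatorsII, (2.83) p.237 + p.249] -/
theorem line2P_le_line3P (p : ℕ) (htri : Triangle254 g) (hd : ∀ a b : g.Site, 0 ≤ g.dist a b) (hL : 0 < g.L)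
    {δ₀ δ₁ σ c D : ℝ} (hδ₀ : 0 ≤ δ₀) (hδ₁ : 0 ≤ δ₁) (hsplit : δ₁ + σ * δ₀ ≤ δ₀ / 4)
    (h261 : Ineq261With c g δ₀ σ) {S' : Finset g.Site} {ρ : g.Site → ℝ} {y y' : g.Site}
    (hρ : ∀ y'' ∈ S', g.dist y'' y' ≤ ρ y'') (hD : ∀ y'' ∈ S', D ≤ g.dist y y'') :
    line283P_2 g p δ₀ δ₁ S' ρ y y' ≤ c * line283P_3 g p δ₀ δ₁ D y y' := by
  have hs := supportSum_le htri hd hL hδ₀ hδ₁ hsplit h261 hρ hD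
  unfold line283P_2 line283P_3
  calc ratioP g p y y' * ∑ y'' ∈ S', Real.exp (-(1 / 2 * δ₀ * g.dist y y'')) * Real.exp (-(δ₁ * ρ y''))
      ≤ ratioP g p y y' * (c * (Real.exp (-(1 / 4 * δ₀ * D)) * Real.exp (-(δ₁ * g.dist y y')))) :=
        mul_le_mul_of_nonneg_left hs (ratioP_nonneg hL.le p y y')
    _ = c * (ratioP g p y y' * Real.exp (-(1 / 4 * δ₀ * D)) * Real.exp (-(δ₁ * g.dist y y'))) := by ring

/-- **MEMBER 3 ≤ MEMBER 4 at power p**: ¼δ₀D ≥ ⅛δ₀Mg + ⅛δ₀RM·max{|j−j′|−1,0} from the gap Mg ≤ D («y ∉ □̃′») and the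
level term ≤ D (`B6Ineq283.levelTerm_le`, (2.60)). [cite: Balaban1984PropagatorsII, (2.83) p.237 + p.249] -/
theorem line3P_le_line4P (p : ℕ) (hL : 0 ≤ g.L) {δ₀ δ₁ D Mg : ℝ} (hδ₀ : 0 ≤ δ₀) {y y' : g.Site} (hgap : Mg ≤ D)
    (hlev : g.R * g.M * mx g y y' ≤ D) :
    line283P_3 g p δ₀ δ₁ D y y' ≤ line283P_4 g p δ₀ δ₁ Mg y y' := by
  unfold line283P_3 line283P_4
  have hkey : Real.exp (-(1 / 4 * δ₀ * D)) ≤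
      Real.exp (-(1 / 8 * δ₀ * Mg)) * Real.exp (-(1 / 8 * δ₀ * g.R * g.M * mx g y y')) := by
    rw [← Real.exp_add, Real.exp_le_exp]
    have h1 : δ₀ * Mg ≤ δ₀ * D := mul_le_mul_of_nonneg_left hgap hδ₀
    have h2 : δ₀ * (g.R * g.M * mx g y y') ≤ δ₀ * D := mul_le_mul_of_nonneg_left hlev hδ₀
    linarith
  have hr := ratioP_nonneg hL p y y'
  calc ratioP g p y y' * Real.exp (-(1 / 4 * δ₀ * D)) * Real.exp (-(δ₁ * g.dist y y'))
      ≤ ratioP g p y y' * (Real.exp (-(1 / 8 * δ₀ * Mg)) * Real.exp (-(1 / 8 * δ₀ * g.R * g.M * mx g y y'))) *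
          Real.exp (-(δ₁ * g.dist y y')) := by gcongr
    _ = Real.exp (-(1 / 8 * δ₀ * Mg)) * ratioP g p y y' * Real.exp (-(1 / 8 * δ₀ * g.R * g.M * mx g y y')) *
          Real.exp (-(δ₁ * g.dist y y')) := by ring

/-- **MEMBER 4 ≤ MEMBER 5 at power p, uniformly in the number of scales**, as soon as L^p ≤ e^{⅛δ₀RM}
(8p·log L ≤ δ₀RM; p = 4: 32 log L ≤ δ₀RM of `B6Ineq283.line4_le_line5`; p = 2: 16 log L ≤ δ₀RM).
[cite: Balaban1984PropagatorsII, (2.83) p.237 + p.249] -/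
theorem line4P_le_line5P (p : ℕ) (hL : 1 ≤ g.L) {δ₀ δ₁ Mg : ℝ} (hδRM : 0 ≤ δ₀ * (g.R * g.M))
    (hthr : g.L ^ p ≤ Real.exp (1 / 8 * δ₀ * g.R * g.M)) (y y' : g.Site) :
    line283P_4 g p δ₀ δ₁ Mg y y' ≤ line283P_5 g p δ₀ δ₁ Mg y y' := by
  unfold line283P_4 line283P_5
  have hβ : 0 ≤ 1 / 8 * δ₀ * g.R * g.M := by linarith [hδRM]
  have h := ratioP_mul_exp_le hL hβ p hthr y y'
  calc Real.exp (-(1 / 8 * δ₀ * Mg)) * ratioP g p y y' * Real.exp (-(1 / 8 * δ₀ * g.R * g.M * mx g y y')) *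
        Real.exp (-(δ₁ * g.dist y y'))
      = ratioP g p y y' * Real.exp (-(1 / 8 * δ₀ * g.R * g.M * mx g y y')) * Real.exp (-(1 / 8 * δ₀ * Mg)) *
          Real.exp (-(δ₁ * g.dist y y')) := by ring
    _ ≤ g.L ^ p * Real.exp (-(1 / 8 * δ₀ * Mg)) * Real.exp (-(δ₁ * g.dist y y')) := by gcongr

/-- **THE WHOLE CHAIN AT POWER p, MEMBER 2 ≤ c · MEMBER 5** — *"We have the same estimates now as before, but with
powers of scaling factors changed properly (we replace +4 and −4 in (2.83) by +2 and −2)"* (p. 249): under (2.54),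
non-negative distance, (2.60) in metric form, (2.61) at α = σ with δ₁ + σδ₀ ≤ ¼δ₀, the straight contour on
supp h_{□′}, D realised by a support point y₀ at the scale of y′, the gap Mg ≤ D and L^p ≤ e^{⅛δ₀RM}.
[cite: Balaban1984PropagatorsII, (2.83) p.237 + p.249] -/
theorem line2P_le_line5P (p : ℕ) (htri : Triangle254 g) (hd : ∀ a b : g.Site, 0 ≤ g.dist a b)
    (hsep : LevelSep g) (hL : 1 ≤ g.L) {δ₀ δ₁ σ c D Mg : ℝ} (hδ₀ : 0 ≤ δ₀) (hδ₁ : 0 ≤ δ₁)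
    (hsplit : δ₁ + σ * δ₀ ≤ δ₀ / 4) (h261 : Ineq261With c g δ₀ σ) (hRM : 0 ≤ g.R * g.M)
    (hthr : g.L ^ p ≤ Real.exp (1 / 8 * δ₀ * g.R * g.M)) {S' : Finset g.Site} {ρ : g.Site → ℝ}
    {y y' y₀ : g.Site} (hρ : ∀ y'' ∈ S', g.dist y'' y' ≤ ρ y'') (hD : ∀ y'' ∈ S', D ≤ g.dist y y'')
    (hsc : g.scale y₀ = g.scale y') (hy₀ : g.dist y y₀ ≤ D) (hgap : Mg ≤ D) :
    line283P_2 g p δ₀ δ₁ S' ρ y y' ≤ c * line283P_5 g p δ₀ δ₁ Mg y y' := by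
  have hL0 : 0 < g.L := zero_lt_one.trans_le hL
  have hc : 0 ≤ c := c_nonneg_of_ineq261With h261 y
  refine (line2P_le_line3P p htri hd hL0 hδ₀ hδ₁ hsplit h261 hρ hD).trans (mul_le_mul_of_nonneg_left ?_ hc)
  exact (line3P_le_line4P p hL0.le hδ₀ hgap (levelTerm_le hsep hsc hy₀)).trans
    (line4P_le_line5P p hL (mul_nonneg hδ₀ hRM) hthr y y')

end Carriers283


/-! ## §3. Member 1 ⇒ member 2 of (2.83) at power p, and the chain to the (2.85) shape -/

section Member1

variable {g : B6.Geometry}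

/-- **(2.83) MEMBER 1 ≤ MEMBER 2 AT POWER p.**  With |w(y″)X(y,y″)| ≤ A_X(L^jη)^p e^{−½δ₀d(y,y″)} (the shape of
(2.142) for p = 2, of (2.68) for p = 4), |C(y″,y′)| ≤ A_C·P(y′)·(L^{j′}η)^{−p}e^{−δ₁ρ(y″)} on S′ = supp h_{□′} and
C(·, y′) = 0 off S′, |□′ − 1| ≤ 1, |h_□| ≤ 1, |h_{□′}| ≤ 1:
|line4Ker(y, y′)| ≤ A_X (A_C P(y′)) · (L^jη)^p(L^{j′}η)^{−p} Σ_{y″∈S′} e^{−½δ₀d(y,y″)}e^{−δ₁ρ(y″)} = A_X A_C P(y′)·`line283P_2`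
— DERIVED from the p = 4 theorem `B6Line4Member12.line4Ker_abs_le` by the reparametrisation A_X ↦ A_X(L^jη)^{p−4},
P(z) ↦ P(z)(L^{z}η)^{4−p} (one row y, one column y′: the powers are spectators of the y″-sum).
[cite: Balaban1984PropagatorsII, (2.83) members 1–2 p.237 + «we replace +4 and −4 in (2.83) by +2 and −2» p.249] -/
theorem line4Ker_abs_le_pow (p : ℕ) (hL : 1 ≤ g.L) (hη : 0 < g.eta) {δ₀ δ₁ AX AC : ℝ} {P : g.Site → ℝ}
    {w p' h h' : g.Site → ℝ} {X C : g.Site → g.Site → ℝ} {S' : Finset g.Site} {ρ : g.Site → ℝ} {y y' : g.Site}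
    (hX : ∀ y'', |w y'' * X y y''| ≤ AX * g.len y ^ p * Real.exp (-(1 / 2 * δ₀ * g.dist y y'')))
    (hC : ∀ y'' ∈ S', |C y'' y'| ≤ AC * P y' / g.len y' ^ p * Real.exp (-(δ₁ * ρ y'')))
    (hC0 : ∀ y'', y'' ∉ S' → C y'' y' = 0)
    (hp1 : |p' y - 1| ≤ 1) (hh1 : |h y| ≤ 1) (hh'1 : ∀ y'', |h' y''| ≤ 1) :
    |line4Ker w p' h h' X C y y'| ≤ AX * (AC * P y') * line283P_2 g p δ₀ δ₁ S' ρ y y' := by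
  have hL0 : 0 < g.L := zero_lt_one.trans_le hL
  have hlen : ∀ z : g.Site, 0 < g.len z := fun z => mul_pos (pow_pos hL0 _) hη
  have hl : g.len y ≠ 0 := (hlen y).ne'
  have hl' : g.len y' ≠ 0 := (hlen y').ne'
  have hl4 : g.len y ^ 4 ≠ 0 := pow_ne_zero 4 hl
  have hl'4 : g.len y' ^ 4 ≠ 0 := pow_ne_zero 4 hl'
  have hl'p : g.len y' ^ p ≠ 0 := pow_ne_zero p hl'
  have hX' : ∀ y'', |w y'' * X y y''| ≤
      AX * g.len y ^ p / g.len y ^ 4 * g.len y ^ 4 * Real.exp (-(1 / 2 * δ₀ * g.dist y y'')) := fun y'' =>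
    (hX y'').trans_eq (by rw [div_mul_cancel₀ _ hl4])
  have hC' : ∀ y'' ∈ S', |C y'' y'| ≤
      AC * (P y' * g.len y' ^ 4 / g.len y' ^ p) / g.len y' ^ 4 * Real.exp (-(δ₁ * ρ y'')) := fun y'' hy'' =>
    (hC y'' hy'').trans_eq (by
      have e : AC * P y' / g.len y' ^ p = AC * (P y' * g.len y' ^ 4 / g.len y' ^ p) / g.len y' ^ 4 := by
        field_simp
      rw [e])
  have h := line4Ker_abs_le hL hη (P := fun z => P z * g.len z ^ 4 / g.len z ^ p) hX' hC' hC0 hp1 hh1 hh'1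
  refine h.trans (le_of_eq ?_)
  unfold line283_2 line283P_2
  rw [ratio4_eq_len hL0.ne' hη.ne', ratioP_eq_len hη.ne']
  field_simp

/-- **MEMBER 1 OF (2.83) IN THE SHAPE (2.85) REQUIRES, AT POWER p**: under the hypotheses of `line4Ker_abs_le_pow`
and of the chain `line2P_le_line5P`, with A_X, A_C, P ≥ 0:
|((□′ − 1)h_□²Xh_{□′}C_{□′}h_{□′})(y, y′)| ≤ (A_X A_C c L^p e^{−⅛δ₀Mg}) · e^{−δ₁d(y,y′)} · P(y′)
(p = 4: `B6Line4Member12.line4Ker_abs_le_285`). [cite: Balaban1984PropagatorsII, (2.83)/(2.85) pp.237–238 + p.249] -/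
theorem line4Ker_abs_le_285_pow (p : ℕ) (htri : Triangle254 g) (hd : ∀ a b : g.Site, 0 ≤ g.dist a b)
    (hsep : LevelSep g) (hL : 1 ≤ g.L) (hη : 0 < g.eta)
    {δ₀ δ₁ σ c D Mg AX AC : ℝ} (hδ₀ : 0 ≤ δ₀) (hδ₁ : 0 ≤ δ₁) (hsplit : δ₁ + σ * δ₀ ≤ δ₀ / 4)
    (h261 : Ineq261With c g δ₀ σ) (hRM : 0 ≤ g.R * g.M)
    (hthr : g.L ^ p ≤ Real.exp (1 / 8 * δ₀ * g.R * g.M)) (hAX : 0 ≤ AX) (hAC : 0 ≤ AC)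
    {P : g.Site → ℝ} (hP : ∀ z, 0 ≤ P z)
    {w p' h h' : g.Site → ℝ} {X C : g.Site → g.Site → ℝ} {S' : Finset g.Site} {ρ : g.Site → ℝ}
    {y y' y₀ : g.Site}
    (hX : ∀ y'', |w y'' * X y y''| ≤ AX * g.len y ^ p * Real.exp (-(1 / 2 * δ₀ * g.dist y y'')))
    (hC : ∀ y'' ∈ S', |C y'' y'| ≤ AC * P y' / g.len y' ^ p * Real.exp (-(δ₁ * ρ y'')))
    (hC0 : ∀ y'', y'' ∉ S' → C y'' y' = 0)
    (hρ : ∀ y'' ∈ S', g.dist y'' y' ≤ ρ y'') (hD : ∀ y'' ∈ S', D ≤ g.dist y y'')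
    (hsc : g.scale y₀ = g.scale y') (hy₀ : g.dist y y₀ ≤ D) (hgap : Mg ≤ D)
    (hp1 : |p' y - 1| ≤ 1) (hh1 : |h y| ≤ 1) (hh'1 : ∀ y'', |h' y''| ≤ 1) :
    |line4Ker w p' h h' X C y y'| ≤
      (AX * AC * c * g.L ^ p * Real.exp (-(1 / 8 * δ₀ * Mg))) * Real.exp (-(δ₁ * g.dist y y')) * P y' := by
  have h1 := line4Ker_abs_le_pow p hL hη hX hC hC0 hp1 hh1 hh'1
  have h25 := line2P_le_line5P p htri hd hsep hL hδ₀ hδ₁ hsplit h261 hRM hthr hρ hD hsc hy₀ hgap (δ₁ := δ₁)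
  calc |line4Ker w p' h h' X C y y'| ≤ AX * (AC * P y') * line283P_2 g p δ₀ δ₁ S' ρ y y' := h1
    _ ≤ AX * (AC * P y') * (c * line283P_5 g p δ₀ δ₁ Mg y y') :=
        mul_le_mul_of_nonneg_left h25 (mul_nonneg hAX (mul_nonneg hAC (hP y')))
    _ = _ := by unfold line283P_5; ring

end Member1

/-! ## §4. The C-side at power p: (2.148)∕(2.81) weighted, and the majorant of C = Σ_□ h_□C_□h_□ -/

section CoverPow

variable {g : B6.Geometry} {D : Type}

/-- **(2.148)∕(2.81) IN THE WEIGHTED FORM, POWER p.**  From |C_□(y″, y′)| ≤ B_C (L^{j_□}η)^{−d−p} e^{−δ₁d(y″,y′)} on □ × □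
and the cube scale fact scale(y′) ≤ j_□ + 1 on □: |C_□(y″, y′)| ≤ (B_C L^{d+p})·(L^{j′}η)^{−d}·(L^{j′}η)^{−p}·e^{−δ₁d(y″,y′)}
(p = 4: `B6Prop23Assembled.ck_weighted_le`; power bookkeeping `scale_bookkeeping_pow`).
[cite: Balaban1984PropagatorsII, (2.81) p.237 + (2.148) p.249] -/
theorem ck_weighted_le_pow (d p : ℕ) (hL : 1 ≤ g.L) (hη : 0 < g.eta) {BC δ₁ : ℝ} (hBC : 0 ≤ BC)
    {pf : D → g.Site → ℝ} {js : D → ℕ} {Ck : D → g.Site → g.Site → ℝ}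
    (hcube : ∀ i y, pf i y ≠ 0 → js i ≤ g.scale y ∧ g.scale y ≤ js i + 1)
    (h2148 : ∀ i y y', pf i y ≠ 0 → pf i y' ≠ 0 →
      |Ck i y y'| ≤ BC / (g.L ^ js i * g.eta) ^ (d + p) * Real.exp (-(δ₁ * g.dist y y')))
    {i : D} {y'' y' : g.Site} (hy'' : pf i y'' ≠ 0) (hy' : pf i y' ≠ 0) :
    |Ck i y'' y'| ≤ BC * g.L ^ (d + p) * (g.len y' ^ d)⁻¹ / g.len y' ^ p * Real.exp (-(δ₁ * g.dist y'' y')) := by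
  have hL0 : 0 < g.L := zero_lt_one.trans_le hL
  have hlen : 0 < g.len y' := mul_pos (pow_pos hL0 _) hη
  have hb : 0 < g.L ^ js i * g.eta := mul_pos (pow_pos hL0 _) hη
  have hsc : g.scale y' ≤ js i + 1 := (hcube i y' hy').2
  have hbook := scale_bookkeeping_pow d p hb hlen.le hlen (len_le_of_scale_le hL hη.le hsc)
    (len_le_of_scale_le hL hη.le hsc)
  have hd0 : 0 < g.len y' ^ d := pow_pos hlen d
  have hcoef : BC / (g.L ^ js i * g.eta) ^ (d + p) ≤ BC * g.L ^ (d + p) * (g.len y' ^ d)⁻¹ / g.len y' ^ p :=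
    calc BC / (g.L ^ js i * g.eta) ^ (d + p)
        = BC * (g.len y' ^ d / (g.L ^ js i * g.eta) ^ (d + p)) * (g.len y' ^ d)⁻¹ := by
          field_simp
      _ ≤ BC * (g.L ^ (d + p) / g.len y' ^ p) * (g.len y' ^ d)⁻¹ :=
          mul_le_mul_of_nonneg_right (mul_le_mul_of_nonneg_left hbook hBC) (inv_nonneg.mpr hd0.le)
      _ = BC * g.L ^ (d + p) * (g.len y' ^ d)⁻¹ / g.len y' ^ p := by ring
  exact (h2148 i y'' y' hy'' hy').trans (mul_le_mul_of_nonneg_right hcoef (Real.exp_pos _).le)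

variable [DecidableEq g.Site] [Fintype D]

/-- **THE MAJORANT OF C = Σ_□ h_□C_□h_□ AT POWER p** (the hypothesis `hC` of `B6Prop23Chain.prop23_matrix` with
P(y) = (L^jη)^{−p}): from |C_□(y,y′)| ≤ B_C(L^{j_□}η)^{−d−p}e^{−δ₁d(y,y′)} on supp h_□ × supp h_□, |h_□| ≤ 1, the overlap
number n₀ and scale ≤ j_□ + 1 on supp h_□:  |mat C y y′| ≤ n₀B_C L^{d+p}(L^jη)^{−p}e^{−δ₁d(y,y′)} (weights (L^{j′}η)^d
of (2.69); p = 4: `B6Prop23Chain.mat_Cglued_abs_le`). [cite: Balaban1984PropagatorsII, (2.81) p.237 + (2.143)/(2.148) pp.248–249] -/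
theorem mat_Cglued_abs_le_pow (d p : ℕ) (hL : 1 ≤ g.L) (hη : 0 < g.eta) (hf : D → g.Site → ℝ)
    (Ck : D → g.Site → g.Site → ℝ) (js : D → ℕ) {n₀ : ℕ}
    (hover : ∀ y, (Finset.univ.filter fun i => hf i y ≠ 0).card ≤ n₀) (hh1 : ∀ i y, |hf i y| ≤ 1)
    (hsc : ∀ i y, hf i y ≠ 0 → g.scale y ≤ js i + 1) {BC δ₁ : ℝ} (hBC : 0 ≤ BC)
    (h2148 : ∀ i y y', hf i y ≠ 0 → hf i y' ≠ 0 →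
      |Ck i y y'| ≤ BC / (g.L ^ js i * g.eta) ^ (d + p) * Real.exp (-(δ₁ * g.dist y y')))
    (y y' : g.Site) :
    |mat (Cglued (fun i => mulOp (hf i)) (fun i => kerOp (fun z => g.len z ^ d) (Ck i))) y y'| ≤
      n₀ * (BC * g.L ^ (d + p)) * (g.len y ^ p)⁻¹ * Real.exp (-(δ₁ * g.dist y y')) := by
  have hL0 : 0 < g.L := zero_lt_one.trans_le hL
  have hlen : ∀ z : g.Site, 0 < g.len z := fun z => mul_pos (pow_pos hL0 _) hη
  have hly : 0 < g.len y := hlen y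
  set K : ℝ := BC * g.L ^ (d + p) * (g.len y ^ p)⁻¹ * Real.exp (-(δ₁ * g.dist y y')) with hK
  have hK0 : 0 ≤ K := by positivity
  have hterm : ∀ i, |mat (mulOp (hf i) * kerOp (fun z => g.len z ^ d) (Ck i) * mulOp (hf i)) y y'| ≤
      if hf i y' ≠ 0 then K else 0 := by
    intro i
    rw [mat_piece]
    by_cases hy' : hf i y' ≠ 0
    · rw [if_pos hy']
      by_cases hy : hf i y ≠ 0
      · have hb : 0 < g.L ^ js i * g.eta := mul_pos (pow_pos hL0 _) hη
        have hbook := scale_bookkeeping_pow d p hb (hlen y').le (hlen y)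
          (len_le_of_scale_le hL hη.le (hsc i y' hy')) (len_le_of_scale_le hL hη.le (hsc i y hy))
        have hmid : |g.len y' ^ d * Ck i y y'| ≤ K := by
          rw [abs_mul, abs_of_pos (pow_pos (hlen y') d)]
          calc g.len y' ^ d * |Ck i y y'|
              ≤ g.len y' ^ d * (BC / (g.L ^ js i * g.eta) ^ (d + p) * Real.exp (-(δ₁ * g.dist y y'))) :=
                mul_le_mul_of_nonneg_left (h2148 i y y' hy hy') (pow_nonneg (hlen y').le d)
            _ = BC * (g.len y' ^ d / (g.L ^ js i * g.eta) ^ (d + p)) * Real.exp (-(δ₁ * g.dist y y')) := by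
                ring
            _ ≤ BC * (g.L ^ (d + p) / g.len y ^ p) * Real.exp (-(δ₁ * g.dist y y')) :=
                mul_le_mul_of_nonneg_right (mul_le_mul_of_nonneg_left hbook hBC) (Real.exp_nonneg _)
            _ = K := by rw [hK]; ring
        calc |hf i y * (g.len y' ^ d * Ck i y y') * hf i y'|
            = |hf i y| * |g.len y' ^ d * Ck i y y'| * |hf i y'| := by rw [abs_mul, abs_mul]
          _ ≤ 1 * K * 1 :=
              mul_le_mul (mul_le_mul (hh1 i y) hmid (abs_nonneg _) zero_le_one) (hh1 i y') (abs_nonneg _)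
                (mul_nonneg zero_le_one hK0)
          _ = K := by ring
      · rw [not_not.mp hy]
        simpa using hK0
    · rw [if_neg hy', not_not.mp hy']
      simp
  unfold Cglued
  rw [mat_sum]
  calc |∑ i, mat (mulOp (hf i) * kerOp (fun z => g.len z ^ d) (Ck i) * mulOp (hf i)) y y'|
      ≤ ∑ i, |mat (mulOp (hf i) * kerOp (fun z => g.len z ^ d) (Ck i) * mulOp (hf i)) y y'| :=
        Finset.abs_sum_le_sum_abs _ _
    _ ≤ ∑ i, (if hf i y' ≠ 0 then K else 0) := Finset.sum_le_sum fun i _ => hterm i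
    _ ≤ n₀ * K := sum_indicator_le _ hK0 (hover y')
    _ = n₀ * (BC * g.L ^ (d + p)) * (g.len y ^ p)⁻¹ * Real.exp (-(δ₁ * g.dist y y')) := by rw [hK]; ring

end CoverPow

/-! ## §5. The three per-term families of the (2.82)-type equality for X·C at power p, in the (2.85) shape -/

section Pieces

variable {g : B6.Geometry} {D : Type}

/-- **LINE 2 (COMMUTATOR FAMILY) AT POWER p, weighted entry.**  For every cube □ and all y, y′:
|(L^{j′}η)^d · ([h_□, □X̃_□□]C_□h_□)(y, y′)| ≤ M⁻¹·(s B_X (B_C L^{d+p}) L^p c_σ ∕(e·¼δ₀))·e^{−δ₁d(y,y′)} — by the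
exponent-free `B6Expansion282.line2Ker_abs_le` (a = ½, b = ¼, A_X = B_X(L^jη)^p, A_C = B_C L^{d+p}(L^{j′}η)^{−d−p}) and
the one-cube fact (L^jη)^p ≤ L^p(L^{j′}η)^p (`len_pow_le`); rows off □ and columns off supp h_□ vanish
(p = 4: `B6Prop23Assembled.commPiece_abs_le`). [cite: Balaban1984PropagatorsII, (2.82) line 2 p.237–238 + p.249] -/
theorem commPiece_abs_le_pow (d p : ℕ) (htri : Triangle254 g) (hd : ∀ a b : g.Site, 0 ≤ g.dist a b) (hL : 1 ≤ g.L)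
    (hη : 0 < g.eta) {δ₀ δ₁ σ cσ s BX BC : ℝ} (hδ₀ : 0 < δ₀) (hδ₁ : 0 ≤ δ₁) (hsplit : δ₁ + σ * δ₀ ≤ δ₀ / 4)
    (h261σ : Ineq261With cσ g δ₀ σ) (hs : 0 ≤ s) (hM : 0 < g.M) (hBX : 0 ≤ BX) (hBC : 0 ≤ BC)
    {pf hf : D → g.Site → ℝ} {js : D → ℕ} {Xw Ck : D → g.Site → g.Site → ℝ}
    (hpf01 : ∀ i y, pf i y = 0 ∨ pf i y = 1) (hph : ∀ i y, pf i y * hf i y = hf i y)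
    (hh1 : ∀ i y, |hf i y| ≤ 1) (hLip : ∀ i y y'', |hf i y - hf i y''| ≤ s / g.M * g.dist y y'')
    (hcube : ∀ i y, pf i y ≠ 0 → js i ≤ g.scale y ∧ g.scale y ≤ js i + 1)
    (hXw : ∀ i y y'', |g.len y'' ^ d * Xw i y y''| ≤ BX * g.len y ^ p * Real.exp (-(1 / 2 * δ₀ * g.dist y y'')))
    (h2148 : ∀ i y y', pf i y ≠ 0 → pf i y' ≠ 0 →
      |Ck i y y'| ≤ BC / (g.L ^ js i * g.eta) ^ (d + p) * Real.exp (-(δ₁ * g.dist y y')))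
    (hCk0 : ∀ i y'' y', pf i y'' = 0 → Ck i y'' y' = 0) (i : D) (y y' : g.Site) :
    |g.len y' ^ d * line2Ker (fun z => g.len z ^ d) (hf i) (fun y y'' => pf i y * Xw i y y'' * pf i y'') (Ck i) y y'|
      ≤ 1 / g.M * (s * BX * (BC * g.L ^ (d + p)) * g.L ^ p * cσ / (Real.exp 1 * (1 / 4 * δ₀))) *
        Real.exp (-(δ₁ * g.dist y y')) := by
  classical
  have hL0 : 0 < g.L := zero_lt_one.trans_le hL
  have hlen : ∀ z : g.Site, 0 < g.len z := fun z => mul_pos (pow_pos hL0 _) hη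
  have hly : 0 < g.len y := hlen y
  have hly' : 0 < g.len y' := hlen y'
  have hc0 : 0 ≤ cσ := c_nonneg_of_ineq261With h261σ y
  have hRHS : 0 ≤ 1 / g.M * (s * BX * (BC * g.L ^ (d + p)) * g.L ^ p * cσ / (Real.exp 1 * (1 / 4 * δ₀))) *
      Real.exp (-(δ₁ * g.dist y y')) := by positivity
  set w : g.Site → ℝ := fun z => g.len z ^ d with hw
  set X' : g.Site → g.Site → ℝ := fun y y'' => pf i y * Xw i y y'' * pf i y'' with hX'
  by_cases hy' : hf i y' = 0
  · have : line2Ker w (hf i) X' (Ck i) y y' = 0 := by unfold line2Ker; rw [hy', mul_zero]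
    rw [this, mul_zero, abs_zero]; exact hRHS
  by_cases hy : pf i y = 0
  · have : line2Ker w (hf i) X' (Ck i) y y' = 0 := by
      unfold line2Ker compKer commKer
      rw [Finset.sum_eq_zero fun y'' _ => by rw [hX']; simp only [hy, zero_mul, mul_zero], zero_mul]
    rw [this, mul_zero, abs_zero]; exact hRHS
  have hpy' : pf i y' ≠ 0 := pf_ne_zero_of_hf_ne_zero hph hy'
  have hsc : g.scale y ≤ g.scale y' + 1 := scale_le_of_cube hcube hy hpy'
  have hsplit' : δ₁ + σ * δ₀ + 1 / 4 * δ₀ ≤ 1 / 2 * δ₀ := by linarith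
  set S' : Finset g.Site := Finset.univ.filter fun y'' => pf i y'' ≠ 0 with hS'
  set AX : ℝ := BX * g.len y ^ p with hAXdef
  set AC : ℝ := BC * g.L ^ (d + p) * (g.len y' ^ d)⁻¹ / g.len y' ^ p with hACdef
  have hAC0 : 0 ≤ AC := by rw [hACdef]; positivity
  have hXb : ∀ y'', |w y'' * X' y y''| ≤ AX * Real.exp (-(1 / 2 * δ₀ * g.dist y y'')) := by
    intro y''
    have e : w y'' * X' y y'' = pf i y * (g.len y'' ^ d * Xw i y y'') * pf i y'' := by rw [hw, hX']; ring
    rw [e, abs_mul, abs_mul]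
    have hA := hXw i y y''
    calc |pf i y| * |g.len y'' ^ d * Xw i y y''| * |pf i y''| ≤ 1 * (BX * g.len y ^ p *
          Real.exp (-(1 / 2 * δ₀ * g.dist y y''))) * 1 :=
          mul_le_mul (mul_le_mul (abs_pf_le_one hpf01 i y) hA (abs_nonneg _) zero_le_one)
            (abs_pf_le_one hpf01 i y'') (abs_nonneg _) (mul_nonneg zero_le_one ((abs_nonneg _).trans hA))
      _ = AX * Real.exp (-(1 / 2 * δ₀ * g.dist y y'')) := by rw [hAXdef]; ring
  have hCb : ∀ y'' ∈ S', |Ck i y'' y'| ≤ AC * Real.exp (-(δ₁ * g.dist y'' y')) := by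
    intro y'' hy''
    exact ck_weighted_le_pow d p hL hη hBC hcube h2148 (Finset.mem_filter.mp hy'').2 hpy'
  have hC0 : ∀ y'', y'' ∉ S' → Ck i y'' y' = 0 := by
    intro y'' hy''
    have : ¬ pf i y'' ≠ 0 := fun h => hy'' (Finset.mem_filter.mpr ⟨Finset.mem_univ _, h⟩)
    exact hCk0 i y'' y' (not_not.mp this)
  have hmain := line2Ker_abs_le htri hd hδ₀ hδ₁ (by norm_num : (0 : ℝ) < 1 / 4) hsplit' h261σ hs hM hAC0
    (w := w) (h := hf i) (X := X') (C := Ck i) (S' := S') (ρ := fun y'' => g.dist y'' y') (y := y) (y' := y')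
    hXb hCb hC0 (fun y'' _ => le_rfl) (hLip i y) (hh1 i y')
  have hpow : g.len y ^ p ≤ g.L ^ p * g.len y' ^ p := len_pow_le p hL hη.le hsc
  have hcoef : g.len y' ^ d * (AX * AC) ≤ BX * (BC * g.L ^ (d + p)) * g.L ^ p := by
    have hd0 : 0 < g.len y' ^ d := pow_pos (hlen y') d
    have hp0 : 0 < g.len y' ^ p := pow_pos (hlen y') p
    rw [hAXdef, hACdef]
    calc g.len y' ^ d * (BX * g.len y ^ p * (BC * g.L ^ (d + p) * (g.len y' ^ d)⁻¹ / g.len y' ^ p))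
        = BX * (BC * g.L ^ (d + p)) * (g.len y ^ p / g.len y' ^ p) * (g.len y' ^ d * (g.len y' ^ d)⁻¹) := by
          ring
      _ = BX * (BC * g.L ^ (d + p)) * (g.len y ^ p / g.len y' ^ p) := by rw [mul_inv_cancel₀ hd0.ne', mul_one]
      _ ≤ BX * (BC * g.L ^ (d + p)) * g.L ^ p := by
          refine mul_le_mul_of_nonneg_left ?_ (by positivity)
          rw [div_le_iff₀ hp0]; exact hpow
  rw [abs_mul, abs_of_pos (pow_pos (hlen y') d)]
  have h1 : 0 ≤ s / g.M := div_nonneg hs hM.le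
  have h2 : 0 ≤ cσ / (Real.exp 1 * (1 / 4 * δ₀)) := by positivity
  calc g.len y' ^ d * |line2Ker w (hf i) X' (Ck i) y y'|
      ≤ g.len y' ^ d * (s / g.M * (AX * AC * cσ / (Real.exp 1 * (1 / 4 * δ₀))) * Real.exp (-(δ₁ * g.dist y y'))) :=
        mul_le_mul_of_nonneg_left hmain (pow_nonneg (hlen y').le d)
    _ = s / g.M * (g.len y' ^ d * (AX * AC)) * (cσ / (Real.exp 1 * (1 / 4 * δ₀))) *
          Real.exp (-(δ₁ * g.dist y y')) := by ring
    _ ≤ s / g.M * (BX * (BC * g.L ^ (d + p)) * g.L ^ p) * (cσ / (Real.exp 1 * (1 / 4 * δ₀))) *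
          Real.exp (-(δ₁ * g.dist y y')) :=
        mul_le_mul_of_nonneg_right (mul_le_mul_of_nonneg_right (mul_le_mul_of_nonneg_left hcoef h1) h2)
          (Real.exp_pos _).le
    _ = _ := by ring

/-- **LINE 3 (CHANGE-OF-DOMAIN FAMILY) AT POWER p, weighted entry.**  With the domain-change majorant in the masked
kernel form |□(y)·w(y″)(X̃_□ − X)(y, y″)·h_□(y″)| ≤ B_D e^{−c₃M}(L^jη)^p e^{−½δ₀d(y,y″)}, (2.148)∕(2.81) at power p and the
cube facts: |(L^{j′}η)^d · (□(X̃_□ − X)h_□C_□h_□)(y, y′)| ≤ (B_D (B_C L^{d+p}) c_σ L^p e^{−c₃M})·e^{−δ₁d(y,y′)} — the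
y″-sum by the ratio-free `supportSum_le` at D = 0, then (L^jη)^p ≤ L^p(L^{j′}η)^p
(p = 4: `B6Prop23Assembled.domPiece_abs_le`). [cite: Balaban1984PropagatorsII, (2.82) line 3 p.237–238 + p.249] -/
theorem domPiece_abs_le_pow (d p : ℕ) (htri : Triangle254 g) (hd : ∀ a b : g.Site, 0 ≤ g.dist a b) (hL : 1 ≤ g.L)
    (hη : 0 < g.eta) {δ₀ δ₁ σ cσ c₃ BD BC : ℝ} (hδ₀ : 0 < δ₀) (hδ₁ : 0 ≤ δ₁) (hsplit : δ₁ + σ * δ₀ ≤ δ₀ / 4)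
    (h261σ : Ineq261With cσ g δ₀ σ) (hBD : 0 ≤ BD) (hBC : 0 ≤ BC)
    {pf hf : D → g.Site → ℝ} {js : D → ℕ} {X : g.Site → g.Site → ℝ} {Xw Ck : D → g.Site → g.Site → ℝ}
    (hph : ∀ i y, pf i y * hf i y = hf i y) (hh1 : ∀ i y, |hf i y| ≤ 1)
    (hcube : ∀ i y, pf i y ≠ 0 → js i ≤ g.scale y ∧ g.scale y ≤ js i + 1)
    (hdom : ∀ i y y'', |pf i y * (g.len y'' ^ d * (Xw i y y'' - X y y'')) * hf i y''| ≤
      BD * Real.exp (-(c₃ * g.M)) * g.len y ^ p * Real.exp (-(1 / 2 * δ₀ * g.dist y y'')))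
    (h2148 : ∀ i y y', pf i y ≠ 0 → pf i y' ≠ 0 →
      |Ck i y y'| ≤ BC / (g.L ^ js i * g.eta) ^ (d + p) * Real.exp (-(δ₁ * g.dist y y')))
    (hCk0 : ∀ i y'' y', pf i y'' = 0 → Ck i y'' y' = 0) (i : D) (y y' : g.Site) :
    |g.len y' ^ d * line3Ker (fun z => g.len z ^ d) (pf i) (hf i) (fun y y'' => Xw i y y'' - X y y'') (Ck i) y y'|
      ≤ (BD * (BC * g.L ^ (d + p)) * cσ * g.L ^ p * Real.exp (-(c₃ * g.M))) * Real.exp (-(δ₁ * g.dist y y')) := by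
  classical
  have hL0 : 0 < g.L := zero_lt_one.trans_le hL
  have hlen : ∀ z : g.Site, 0 < g.len z := fun z => mul_pos (pow_pos hL0 _) hη
  have hly : 0 < g.len y := hlen y
  have hly' : 0 < g.len y' := hlen y'
  have hc0 : 0 ≤ cσ := c_nonneg_of_ineq261With h261σ y
  have hRHS : 0 ≤ (BD * (BC * g.L ^ (d + p)) * cσ * g.L ^ p * Real.exp (-(c₃ * g.M))) *
      Real.exp (-(δ₁ * g.dist y y')) := by positivity
  set w : g.Site → ℝ := fun z => g.len z ^ d with hw
  set Y : g.Site → g.Site → ℝ := fun y y'' => Xw i y y'' - X y y'' with hY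
  by_cases hy' : hf i y' = 0
  · have : line3Ker w (pf i) (hf i) Y (Ck i) y y' = 0 := by unfold line3Ker; rw [hy', mul_zero]
    rw [this, mul_zero, abs_zero]; exact hRHS
  by_cases hy : pf i y = 0
  · have : line3Ker w (pf i) (hf i) Y (Ck i) y y' = 0 := by unfold line3Ker; rw [hy, zero_mul, zero_mul]
    rw [this, mul_zero, abs_zero]; exact hRHS
  have hpy' : pf i y' ≠ 0 := pf_ne_zero_of_hf_ne_zero hph hy'
  have hsc : g.scale y ≤ g.scale y' + 1 := scale_le_of_cube hcube hy hpy'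
  set S' : Finset g.Site := Finset.univ.filter fun y'' => pf i y'' ≠ 0 with hS'
  set AC : ℝ := BC * g.L ^ (d + p) * (g.len y' ^ d)⁻¹ / g.len y' ^ p with hAC
  have hAC0 : 0 ≤ AC := by rw [hAC]; positivity
  have hCb : ∀ y'' ∈ S', |Ck i y'' y'| ≤ AC * Real.exp (-(δ₁ * g.dist y'' y')) := by
    intro y'' hy''
    exact ck_weighted_le_pow d p hL hη hBC hcube h2148 (Finset.mem_filter.mp hy'').2 hpy'
  have hC0 : ∀ y'', y'' ∉ S' → Ck i y'' y' = 0 := by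
    intro y'' hy''
    have : ¬ pf i y'' ≠ 0 := fun h => hy'' (Finset.mem_filter.mpr ⟨Finset.mem_univ _, h⟩)
    exact hCk0 i y'' y' (not_not.mp this)
  set K : ℝ := BD * Real.exp (-(c₃ * g.M)) * g.len y ^ p with hK
  have hK0 : 0 ≤ K := by positivity
  have hsum_eq : pf i y * (∑ y'', w y'' * Y y y'' * hf i y'' * Ck i y'' y') =
      ∑ y'' ∈ S', (pf i y * (g.len y'' ^ d * Y y y'') * hf i y'') * Ck i y'' y' := by
    rw [Finset.mul_sum]
    rw [← Finset.sum_subset (Finset.subset_univ S') fun y'' _ hy'' => by simp only [hC0 y'' hy'', mul_zero]]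
    exact Finset.sum_congr rfl fun y'' _ => by rw [hw]; ring
  have hsum : |pf i y * (∑ y'', w y'' * Y y y'' * hf i y'' * Ck i y'' y')| ≤
      K * AC * ∑ y'' ∈ S', Real.exp (-(1 / 2 * δ₀ * g.dist y y'')) * Real.exp (-(δ₁ * g.dist y'' y')) := by
    rw [hsum_eq, Finset.mul_sum]
    refine (Finset.abs_sum_le_sum_abs _ _).trans (Finset.sum_le_sum fun y'' hy'' => ?_)
    rw [abs_mul]
    have hA := hdom i y y''
    have hB := hCb y'' hy''
    calc |pf i y * (g.len y'' ^ d * Y y y'') * hf i y''| * |Ck i y'' y'|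
        ≤ (K * Real.exp (-(1 / 2 * δ₀ * g.dist y y''))) * (AC * Real.exp (-(δ₁ * g.dist y'' y'))) :=
          mul_le_mul (by rw [hK, hY]; exact hA) hB (abs_nonneg _) (by positivity)
      _ = K * AC * (Real.exp (-(1 / 2 * δ₀ * g.dist y y'')) * Real.exp (-(δ₁ * g.dist y'' y'))) := by ring
  -- the single-scale sum by (2.54) + (2.61) with D = 0, then the cube ratio (L^jη)^p ≤ L^p (L^{j′}η)^p
  have hsumS : ∑ y'' ∈ S', Real.exp (-(1 / 2 * δ₀ * g.dist y y'')) * Real.exp (-(δ₁ * g.dist y'' y')) ≤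
      cσ * Real.exp (-(δ₁ * g.dist y y')) := by
    have h := supportSum_le htri hd hL0 hδ₀.le hδ₁ hsplit h261σ (S' := S') (ρ := fun y'' => g.dist y'' y')
      (y := y) (y' := y') (D := 0) (fun y'' _ => le_rfl) (fun y'' _ => hd y y'')
    refine h.trans (le_of_eq ?_)
    rw [mul_zero, neg_zero, Real.exp_zero, one_mul]
  have hpow : g.len y ^ p ≤ g.L ^ p * g.len y' ^ p := len_pow_le p hL hη.le hsc
  have hfin : g.len y' ^ d * (K * AC * (cσ * Real.exp (-(δ₁ * g.dist y y')))) ≤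
      (BD * (BC * g.L ^ (d + p)) * cσ * g.L ^ p * Real.exp (-(c₃ * g.M))) * Real.exp (-(δ₁ * g.dist y y')) := by
    have hd0 : 0 < g.len y' ^ d := pow_pos (hlen y') d
    have hp0 : 0 < g.len y' ^ p := pow_pos (hlen y') p
    rw [hK, hAC]
    calc g.len y' ^ d * (BD * Real.exp (-(c₃ * g.M)) * g.len y ^ p *
          (BC * g.L ^ (d + p) * (g.len y' ^ d)⁻¹ / g.len y' ^ p) * (cσ * Real.exp (-(δ₁ * g.dist y y'))))
        = BD * (BC * g.L ^ (d + p)) * cσ * (g.len y ^ p / g.len y' ^ p) * Real.exp (-(c₃ * g.M)) *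
            Real.exp (-(δ₁ * g.dist y y')) * (g.len y' ^ d * (g.len y' ^ d)⁻¹) := by ring
      _ = BD * (BC * g.L ^ (d + p)) * cσ * (g.len y ^ p / g.len y' ^ p) * Real.exp (-(c₃ * g.M)) *
            Real.exp (-(δ₁ * g.dist y y')) := by rw [mul_inv_cancel₀ hd0.ne', mul_one]
      _ ≤ BD * (BC * g.L ^ (d + p)) * cσ * g.L ^ p * Real.exp (-(c₃ * g.M)) *
            Real.exp (-(δ₁ * g.dist y y')) := by
          have hq : g.len y ^ p / g.len y' ^ p ≤ g.L ^ p := by rw [div_le_iff₀ hp0]; exact hpow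
          have h0 : 0 ≤ BD * (BC * g.L ^ (d + p)) * cσ := by positivity
          exact mul_le_mul_of_nonneg_right (mul_le_mul_of_nonneg_right (mul_le_mul_of_nonneg_left hq h0)
            (Real.exp_pos _).le) (Real.exp_pos _).le
  rw [abs_mul, abs_of_pos (pow_pos (hlen y') d)]
  calc g.len y' ^ d * |line3Ker w (pf i) (hf i) Y (Ck i) y y'|
      = g.len y' ^ d * (|pf i y * (∑ y'', w y'' * Y y y'' * hf i y'' * Ck i y'' y')| * |hf i y'|) := by
        unfold line3Ker; rw [abs_mul]
    _ ≤ g.len y' ^ d * (K * AC * (∑ y'' ∈ S', Real.exp (-(1 / 2 * δ₀ * g.dist y y'')) *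
          Real.exp (-(δ₁ * g.dist y'' y'))) * 1) :=
        mul_le_mul_of_nonneg_left (mul_le_mul hsum (hh1 i y') (abs_nonneg _) (by positivity))
          (pow_nonneg (hlen y').le d)
    _ ≤ g.len y' ^ d * (K * AC * (cσ * Real.exp (-(δ₁ * g.dist y y')))) := by
        rw [mul_one]
        exact mul_le_mul_of_nonneg_left (mul_le_mul_of_nonneg_left hsumS (mul_nonneg hK0 hAC0))
          (pow_nonneg (hlen y').le d)
    _ ≤ _ := hfin

/-- **LINE 4 (THE FAMILY □ ≠ □′, (2.83)) AT POWER p, weighted entry.**  For all cubes □, □′ and all y, y′: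
|(L^{j′}η)^d · ((□′ − 1)h_□²Xh_{□′}C_{□′}h_{□′})(y, y′)| ≤ (B_X (B_C L^{d+p}) c_σ L^p e^{−⅛δ₀·m_g M})·e^{−δ₁d(y,y′)} — by
`line4Ker_abs_le_285_pow` with C_{□′} masked to supp h_{□′}, D = d(y, supp h_{□′}) realised by a nearest support point,
the gap m_g·M ≤ D for y ∉ □′; rows y ∈ □′ vanish by the factor (□′ − 1), columns off supp h_{□′} by h_{□′}(y′)
(p = 4: `B6Prop23Assembled.offPiece_abs_le`). [cite: Balaban1984PropagatorsII, (2.83) p.237 + p.249] -/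
theorem offPiece_abs_le_pow (d p : ℕ) (htri : Triangle254 g) (hd : ∀ a b : g.Site, 0 ≤ g.dist a b)
    (hsep : LevelSep g) (hL : 1 ≤ g.L) (hη : 0 < g.eta) {δ₀ δ₁ σ cσ mg BX BC : ℝ} (hδ₀ : 0 < δ₀)
    (hδ₁ : 0 ≤ δ₁) (hsplit : δ₁ + σ * δ₀ ≤ δ₀ / 4) (h261σ : Ineq261With cσ g δ₀ σ) (hRM : 0 ≤ g.R * g.M)
    (hthr : g.L ^ p ≤ Real.exp (1 / 8 * δ₀ * g.R * g.M)) (hBX : 0 ≤ BX) (hBC : 0 ≤ BC)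
    {pf hf : D → g.Site → ℝ} {js : D → ℕ} {X : g.Site → g.Site → ℝ} {Ck : D → g.Site → g.Site → ℝ}
    (hpf01 : ∀ i y, pf i y = 0 ∨ pf i y = 1) (hph : ∀ i y, pf i y * hf i y = hf i y)
    (hh1 : ∀ i y, |hf i y| ≤ 1) (hcube : ∀ i y, pf i y ≠ 0 → js i ≤ g.scale y ∧ g.scale y ≤ js i + 1)
    (hlev : ∀ i y y', hf i y ≠ 0 → hf i y' ≠ 0 → g.scale y = g.scale y')
    (hgap : ∀ i y y'', pf i y = 0 → hf i y'' ≠ 0 → mg * g.M ≤ g.dist y y'')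
    (hX : ∀ y y'', |g.len y'' ^ d * X y y''| ≤ BX * g.len y ^ p * Real.exp (-(1 / 2 * δ₀ * g.dist y y'')))
    (h2148 : ∀ i y y', pf i y ≠ 0 → pf i y' ≠ 0 →
      |Ck i y y'| ≤ BC / (g.L ^ js i * g.eta) ^ (d + p) * Real.exp (-(δ₁ * g.dist y y')))
    (i i' : D) (y y' : g.Site) :
    |g.len y' ^ d * line4Ker (fun z => g.len z ^ d) (pf i') (hf i) (hf i') X (Ck i') y y'| ≤
      (BX * (BC * g.L ^ (d + p)) * cσ * g.L ^ p * Real.exp (-(1 / 8 * δ₀ * (mg * g.M)))) *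
        Real.exp (-(δ₁ * g.dist y y')) := by
  classical
  have hL0 : 0 < g.L := zero_lt_one.trans_le hL
  have hlen : ∀ z : g.Site, 0 < g.len z := fun z => mul_pos (pow_pos hL0 _) hη
  have hly : 0 < g.len y := hlen y
  have hly' : 0 < g.len y' := hlen y'
  have hc0 : 0 ≤ cσ := c_nonneg_of_ineq261With h261σ y
  have hRHS : 0 ≤ (BX * (BC * g.L ^ (d + p)) * cσ * g.L ^ p * Real.exp (-(1 / 8 * δ₀ * (mg * g.M)))) *
      Real.exp (-(δ₁ * g.dist y y')) := by positivity
  set w : g.Site → ℝ := fun z => g.len z ^ d with hw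
  by_cases hy' : hf i' y' = 0
  · have : line4Ker w (pf i') (hf i) (hf i') X (Ck i') y y' = 0 := by unfold line4Ker; rw [hy', mul_zero]
    rw [this, mul_zero, abs_zero]; exact hRHS
  by_cases hy : pf i' y = 0
  swap
  · have h1 : pf i' y = 1 := (hpf01 i' y).resolve_left hy
    have : line4Ker w (pf i') (hf i) (hf i') X (Ck i') y y' = 0 := by
      unfold line4Ker; rw [h1, sub_self, zero_mul, zero_mul, zero_mul]
    rw [this, mul_zero, abs_zero]; exact hRHS
  have hpy' : pf i' y' ≠ 0 := pf_ne_zero_of_hf_ne_zero hph hy'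
  set C' : g.Site → g.Site → ℝ := fun y'' z => if hf i' y'' = 0 then 0 else Ck i' y'' z with hC'
  set S' : Finset g.Site := Finset.univ.filter fun y'' => hf i' y'' ≠ 0 with hS'
  have hne : S'.Nonempty := ⟨y', Finset.mem_filter.mpr ⟨Finset.mem_univ _, hy'⟩⟩
  obtain ⟨y₀, hy₀S, hy₀min⟩ := Finset.exists_min_image S' (fun y'' => g.dist y y'') hne
  have hy₀ : hf i' y₀ ≠ 0 := (Finset.mem_filter.mp hy₀S).2
  set Dm : ℝ := g.dist y y₀ with hDm
  have hCb : ∀ y'' ∈ S', |C' y'' y'| ≤ BC * g.L ^ (d + p) * (g.len y' ^ d)⁻¹ / g.len y' ^ p *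
      Real.exp (-(δ₁ * g.dist y'' y')) := by
    intro y'' hy''
    have h'' : hf i' y'' ≠ 0 := (Finset.mem_filter.mp hy'').2
    rw [hC']; simp only [if_neg h'']
    exact ck_weighted_le_pow d p hL hη hBC hcube h2148 (pf_ne_zero_of_hf_ne_zero hph h'') hpy'
  have hC0 : ∀ y'', y'' ∉ S' → C' y'' y' = 0 := by
    intro y'' hy''
    have : ¬ hf i' y'' ≠ 0 := fun h => hy'' (Finset.mem_filter.mpr ⟨Finset.mem_univ _, h⟩)
    rw [hC']; simp only [not_not.mp this, if_true]
  have hmain := line4Ker_abs_le_285_pow p htri hd hsep hL hη hδ₀.le hδ₁ hsplit h261σ hRM hthr hBX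
    (by positivity : 0 ≤ BC * g.L ^ (d + p)) (P := fun z => (g.len z ^ d)⁻¹)
    (fun z => inv_nonneg.mpr (pow_nonneg (hlen z).le d)) (w := w) (p' := pf i') (h := hf i) (h' := hf i')
    (X := X) (C := C') (S' := S') (ρ := fun y'' => g.dist y'' y') (y := y) (y' := y') (y₀ := y₀) (D := Dm)
    (Mg := mg * g.M) (hX y) hCb hC0 (fun y'' _ => le_rfl) (fun y'' hy'' => hy₀min y'' hy'')
    (hlev i' y₀ y' hy₀ hy') le_rfl (hgap i' y y₀ hy hy₀) (abs_pf_sub_one_le_one hpf01 i' y) (hh1 i y)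
    (hh1 i')
  have hwP : g.len y' ^ d * (g.len y' ^ d)⁻¹ = 1 := mul_inv_cancel₀ (pow_pos (hlen y') d).ne'
  rw [line4Ker_mask, abs_mul, abs_of_pos (pow_pos (hlen y') d)]
  calc g.len y' ^ d * |line4Ker w (pf i') (hf i) (hf i') X C' y y'|
      ≤ g.len y' ^ d * ((BX * (BC * g.L ^ (d + p)) * cσ * g.L ^ p * Real.exp (-(1 / 8 * δ₀ * (mg * g.M)))) *
          Real.exp (-(δ₁ * g.dist y y')) * (g.len y' ^ d)⁻¹) :=
        mul_le_mul_of_nonneg_left hmain (pow_nonneg (hlen y').le d)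
    _ = (BX * (BC * g.L ^ (d + p)) * cσ * g.L ^ p * Real.exp (-(1 / 8 * δ₀ * (mg * g.M)))) *
          Real.exp (-(δ₁ * g.dist y y')) * (g.len y' ^ d * (g.len y' ^ d)⁻¹) := by ring
    _ = _ := by rw [hwP, mul_one]

end Pieces

/-! ## §6. The assembly at power p: (2.82)-type equality + (2.85) + Lemma 2.1 ⟹ the inverse with the (2.87)/(2.149) kernel bound -/

section Assembly

variable {g : B6.Geometry} [DecidableEq g.Site] {D : Type} [Fintype D] [DecidableEq D]

/-- κ₂ at power p: the size of the commutator family (M·ε, `commPiece_abs_le_pow`; p = 4: `B6Prop23Assembled.kappa2`).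
[cite: Balaban1984PropagatorsII, (2.85) p.238 + p.249] -/
noncomputable def kappa2P (g : B6.Geometry) (d p : ℕ) (s δ₀ cσ BX BC : ℝ) : ℝ :=
  s * BX * (BC * g.L ^ (d + p)) * g.L ^ p * cσ / (Real.exp 1 * (1 / 4 * δ₀))

/-- κ₃ at power p: the size of the change-of-domain family in front of e^{−c₃M} (`domPiece_abs_le_pow`; p = 4: `kappa3`).
[cite: Balaban1984PropagatorsII, (2.85) p.238 + p.249] -/
noncomputable def kappa3P (g : B6.Geometry) (d p : ℕ) (cσ BD BC : ℝ) : ℝ :=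
  BD * (BC * g.L ^ (d + p)) * cσ * g.L ^ p

/-- κ₄ at power p: the size of the off-diagonal family in front of e^{−⅛δ₀m_gM} (`offPiece_abs_le_pow`; p = 4: `kappa4`).
[cite: Balaban1984PropagatorsII, (2.83)/(2.85) pp.237–238 + p.249] -/
noncomputable def kappa4P (g : B6.Geometry) (d p : ℕ) (cσ BX BC : ℝ) : ℝ :=
  BX * (BC * g.L ^ (d + p)) * cσ * g.L ^ p

/-- θ of (2.85) at power p: θ = n₀(κ₂/M + κ₃e^{−c₃M}) + n₀²κ₄e^{−(⅛δ₀m_g)M} (p = 4: `B6Prop23Assembled.theta285`).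
[cite: Balaban1984PropagatorsII, (2.85) p.238 + «thus we have (2.85)» p.249] -/
noncomputable def theta285P (g : B6.Geometry) (d p n₀ : ℕ) (s δ₀ cσ c₃ mg BX BD BC : ℝ) : ℝ :=
  n₀ * (kappa2P g d p s δ₀ cσ BX BC / g.M + kappa3P g d p cσ BD BC * Real.exp (-(c₃ * g.M))) +
    n₀ ^ 2 * (kappa4P g d p cσ BX BC * Real.exp (-((1 / 8 * δ₀ * mg) * g.M)))

/-- K at power p with θ ≤ K/M: K = n₀(κ₂ + κ₃/(e c₃)) + n₀²κ₄/(e·⅛δ₀m_g) (p = 4: `B6Prop23Assembled.K285`).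
[cite: Balaban1984PropagatorsII, (2.85) p.238 + p.249] -/
noncomputable def K285P (g : B6.Geometry) (d p n₀ : ℕ) (s δ₀ cσ c₃ mg BX BD BC : ℝ) : ℝ :=
  n₀ * (kappa2P g d p s δ₀ cσ BX BC + kappa3P g d p cσ BD BC / (Real.exp 1 * c₃)) +
    n₀ ^ 2 * (kappa4P g d p cσ BX BC / (Real.exp 1 * (1 / 8 * δ₀ * mg)))

omit [DecidableEq g.Site] [Fintype D] [DecidableEq D] in
/-- DICTIONARY p = 4: κ₂ at power 4 is `B6Prop23Assembled.kappa2`. [folklore] -/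
theorem kappa2P_four (d : ℕ) (s δ₀ cσ BX BC : ℝ) : kappa2P g d 4 s δ₀ cσ BX BC = kappa2 g d s δ₀ cσ BX BC := rfl

omit [DecidableEq g.Site] [Fintype D] [DecidableEq D] in
/-- DICTIONARY p = 4: κ₃ at power 4 is `B6Prop23Assembled.kappa3`. [folklore] -/
theorem kappa3P_four (d : ℕ) (cσ BD BC : ℝ) : kappa3P g d 4 cσ BD BC = kappa3 g d cσ BD BC := rfl

omit [DecidableEq g.Site] [Fintype D] [DecidableEq D] in
/-- DICTIONARY p = 4: κ₄ at power 4 is `B6Prop23Assembled.kappa4`. [folklore] -/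
theorem kappa4P_four (d : ℕ) (cσ BX BC : ℝ) : kappa4P g d 4 cσ BX BC = kappa4 g d cσ BX BC := rfl

omit [DecidableEq g.Site] [Fintype D] [DecidableEq D] in
/-- DICTIONARY p = 4: θ at power 4 is `B6Prop23Assembled.theta285`. [folklore] -/
theorem theta285P_four (d n₀ : ℕ) (s δ₀ cσ c₃ mg BX BD BC : ℝ) :
    theta285P g d 4 n₀ s δ₀ cσ c₃ mg BX BD BC = theta285 g d n₀ s δ₀ cσ c₃ mg BX BD BC := rfl

omit [DecidableEq g.Site] [Fintype D] [DecidableEq D] in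
/-- DICTIONARY p = 4: K at power 4 is `B6Prop23Assembled.K285` — so the threshold «M ≥ 2Kc» of the power-p assembly
at p = 4 is literally the one of `B6Prop23Assembled.prop23_assembled`. [folklore] -/
theorem K285P_four (d n₀ : ℕ) (s δ₀ cσ c₃ mg BX BD BC : ℝ) :
    K285P g d 4 n₀ s δ₀ cσ c₃ mg BX BD BC = K285 g d n₀ s δ₀ cσ c₃ mg BX BD BC := rfl

omit [Fintype D] in
/-- **THE DIAGONAL TERMS R_{□,□}C_□h_□ AT POWER p**: |mat(R_{□,□}C_□h_□) y y′| ≤ (κ₂/M + κ₃e^{−c₃M})·e^{−δ₁d(y,y′)}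
(p = 4: `B6Prop23Assembled.mat_diag_abs_le`). [cite: Balaban1984PropagatorsII, (2.82)/(2.85) pp.237–238 + p.249] -/
theorem mat_diag_abs_le_pow (d p : ℕ) (htri : Triangle254 g) (hd : ∀ a b : g.Site, 0 ≤ g.dist a b) (hL : 1 ≤ g.L)
    (hη : 0 < g.eta) {δ₀ δ₁ σ cσ c₃ s BX BD BC : ℝ} (hδ₀ : 0 < δ₀) (hδ₁ : 0 ≤ δ₁)
    (hsplit : δ₁ + σ * δ₀ ≤ δ₀ / 4) (h261σ : Ineq261With cσ g δ₀ σ) (hs : 0 ≤ s) (hM : 0 < g.M)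
    (hBX : 0 ≤ BX) (hBD : 0 ≤ BD) (hBC : 0 ≤ BC)
    {pf hf : D → g.Site → ℝ} {js : D → ℕ} {X : g.Site → g.Site → ℝ} {Xw Ck : D → g.Site → g.Site → ℝ}
    (hpf01 : ∀ i y, pf i y = 0 ∨ pf i y = 1) (hph : ∀ i y, pf i y * hf i y = hf i y)
    (hh1 : ∀ i y, |hf i y| ≤ 1) (hLip : ∀ i y y'', |hf i y - hf i y''| ≤ s / g.M * g.dist y y'')
    (hcube : ∀ i y, pf i y ≠ 0 → js i ≤ g.scale y ∧ g.scale y ≤ js i + 1)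
    (hXw : ∀ i y y'', |g.len y'' ^ d * Xw i y y''| ≤ BX * g.len y ^ p * Real.exp (-(1 / 2 * δ₀ * g.dist y y'')))
    (hdom : ∀ i y y'', |pf i y * (g.len y'' ^ d * (Xw i y y'' - X y y'')) * hf i y''| ≤
      BD * Real.exp (-(c₃ * g.M)) * g.len y ^ p * Real.exp (-(1 / 2 * δ₀ * g.dist y y'')))
    (h2148 : ∀ i y y', pf i y ≠ 0 → pf i y' ≠ 0 →
      |Ck i y y'| ≤ BC / (g.L ^ js i * g.eta) ^ (d + p) * Real.exp (-(δ₁ * g.dist y y')))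
    (hCk0 : ∀ i y'' y', pf i y'' = 0 → Ck i y'' y' = 0) (i : D) (y y' : g.Site) :
    |mat (Rpair (kerOp (fun z => g.len z ^ d) X) (fun i => mulOp (pf i))
        (fun i => kerOp (fun z => g.len z ^ d) (Xw i)) (fun i => mulOp (hf i)) i i *
        kerOp (fun z => g.len z ^ d) (Ck i) * mulOp (hf i)) y y'| ≤
      (kappa2P g d p s δ₀ cσ BX BC / g.M + kappa3P g d p cσ BD BC * Real.exp (-(c₃ * g.M))) *
        Real.exp (-(δ₁ * g.dist y y')) := by
  set w : g.Site → ℝ := fun z => g.len z ^ d with hw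
  have hop : Rpair (kerOp w X) (fun i => mulOp (pf i)) (fun i => kerOp w (Xw i)) (fun i => mulOp (hf i)) i i *
        kerOp w (Ck i) * mulOp (hf i) =
      kerOp w (line2Ker w (hf i) (fun y y'' => pf i y * Xw i y y'' * pf i y'') (Ck i)) +
        kerOp w (line3Ker w (pf i) (hf i) (fun y y'' => Xw i y y'' - X y y'') (Ck i)) := by
    rw [Rpair_self, add_mul, add_mul, locOp_kerOp, line2_operator_eq, kerOp_sub_kerOp, line3_operator_eq]
  rw [hop, mat_add, mat_kerOp, mat_kerOp]
  have h2 := commPiece_abs_le_pow d p htri hd hL hη hδ₀ hδ₁ hsplit h261σ hs hM hBX hBC hpf01 hph hh1 hLip hcube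
    hXw h2148 hCk0 i y y'
  have h3 := domPiece_abs_le_pow d p htri hd hL hη hδ₀ hδ₁ hsplit h261σ hBD hBC (X := X) hph hh1 hcube hdom h2148
    hCk0 i y y'
  refine (abs_add_le _ _).trans ((add_le_add h2 h3).trans (le_of_eq ?_))
  simp only [kappa2P, kappa3P]
  ring

omit [Fintype D] in
/-- **THE OFF-DIAGONAL TERMS R_{□,□′}C_{□′}h_{□′}, □ ≠ □′, AT POWER p**: |mat(R_{□,□′}C_{□′}h_{□′}) y y′| ≤
κ₄e^{−(⅛δ₀m_g)M}·e^{−δ₁d(y,y′)} (p = 4: `B6Prop23Assembled.mat_off_abs_le`).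
[cite: Balaban1984PropagatorsII, (2.83)/(2.85) pp.237–238 + p.249] -/
theorem mat_off_abs_le_pow (d p : ℕ) (htri : Triangle254 g) (hd : ∀ a b : g.Site, 0 ≤ g.dist a b)
    (hsep : LevelSep g) (hL : 1 ≤ g.L) (hη : 0 < g.eta) {δ₀ δ₁ σ cσ mg BX BC : ℝ} (hδ₀ : 0 < δ₀)
    (hδ₁ : 0 ≤ δ₁) (hsplit : δ₁ + σ * δ₀ ≤ δ₀ / 4) (h261σ : Ineq261With cσ g δ₀ σ) (hRM : 0 ≤ g.R * g.M)
    (hthr : g.L ^ p ≤ Real.exp (1 / 8 * δ₀ * g.R * g.M)) (hBX : 0 ≤ BX) (hBC : 0 ≤ BC)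
    {pf hf : D → g.Site → ℝ} {js : D → ℕ} {X : g.Site → g.Site → ℝ} {Xw Ck : D → g.Site → g.Site → ℝ}
    (hpf01 : ∀ i y, pf i y = 0 ∨ pf i y = 1) (hph : ∀ i y, pf i y * hf i y = hf i y)
    (hh1 : ∀ i y, |hf i y| ≤ 1) (hcube : ∀ i y, pf i y ≠ 0 → js i ≤ g.scale y ∧ g.scale y ≤ js i + 1)
    (hlev : ∀ i y y', hf i y ≠ 0 → hf i y' ≠ 0 → g.scale y = g.scale y')
    (hgap : ∀ i y y'', pf i y = 0 → hf i y'' ≠ 0 → mg * g.M ≤ g.dist y y'')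
    (hX : ∀ y y'', |g.len y'' ^ d * X y y''| ≤ BX * g.len y ^ p * Real.exp (-(1 / 2 * δ₀ * g.dist y y'')))
    (h2148 : ∀ i y y', pf i y ≠ 0 → pf i y' ≠ 0 →
      |Ck i y y'| ≤ BC / (g.L ^ js i * g.eta) ^ (d + p) * Real.exp (-(δ₁ * g.dist y y')))
    {i i' : D} (hii : i ≠ i') (y y' : g.Site) :
    |mat (Rpair (kerOp (fun z => g.len z ^ d) X) (fun i => mulOp (pf i))
        (fun i => kerOp (fun z => g.len z ^ d) (Xw i)) (fun i => mulOp (hf i)) i i' *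
        kerOp (fun z => g.len z ^ d) (Ck i') * mulOp (hf i')) y y'| ≤
      kappa4P g d p cσ BX BC * Real.exp (-((1 / 8 * δ₀ * mg) * g.M)) * Real.exp (-(δ₁ * g.dist y y')) := by
  set w : g.Site → ℝ := fun z => g.len z ^ d with hw
  have hop : Rpair (kerOp w X) (fun i => mulOp (pf i)) (fun i => kerOp w (Xw i)) (fun i => mulOp (hf i)) i i' *
        kerOp w (Ck i') * mulOp (hf i') = kerOp w (line4Ker w (pf i') (hf i) (hf i') X (Ck i')) := by
    rw [Rpair_ne _ _ _ _ hii, line4_operator_eq]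
  rw [hop, mat_kerOp]
  have h4 := offPiece_abs_le_pow d p htri hd hsep hL hη hδ₀ hδ₁ hsplit h261σ hRM hthr hBX hBC hpf01 hph hh1 hcube
    hlev hgap hX h2148 i i' y y'
  refine h4.trans (le_of_eq ?_)
  simp only [kappa4P]
  ring_nf

/-- **(2.85) AT POWER p WITH NO PER-TERM HYPOTHESIS LEFT**: |mat R y y′| ≤ θ·e^{−δ₁d(y,y′)}, θ = `theta285P`
(p = 4: `B6Prop23Assembled.mat_R_abs_le`). [cite: Balaban1984PropagatorsII, (2.85) p.238 + «thus we have (2.85)» p.249] -/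
theorem mat_R_abs_le_pow (d p : ℕ) (htri : Triangle254 g) (hd : ∀ a b : g.Site, 0 ≤ g.dist a b)
    (hsep : LevelSep g) (hL : 1 ≤ g.L) (hη : 0 < g.eta) (hM : 0 < g.M) (hRM : 0 ≤ g.R * g.M)
    {δ₀ δ₁ σ cσ c₃ s mg BX BD BC : ℝ} (hδ₀ : 0 < δ₀) (hδ₁ : 0 ≤ δ₁) (hsplit : δ₁ + σ * δ₀ ≤ δ₀ / 4)
    (h261σ : Ineq261With cσ g δ₀ σ) (hthr : g.L ^ p ≤ Real.exp (1 / 8 * δ₀ * g.R * g.M)) (hs : 0 ≤ s)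
    (hBX : 0 ≤ BX) (hBD : 0 ≤ BD) (hBC : 0 ≤ BC)
    {pf hf : D → g.Site → ℝ} {js : D → ℕ} {n₀ : ℕ} {X : g.Site → g.Site → ℝ}
    {Xw Ck : D → g.Site → g.Site → ℝ}
    (hover : ∀ y, (Finset.univ.filter fun i => hf i y ≠ 0).card ≤ n₀)
    (hpf01 : ∀ i y, pf i y = 0 ∨ pf i y = 1) (hph : ∀ i y, pf i y * hf i y = hf i y)
    (hh1 : ∀ i y, |hf i y| ≤ 1) (hLip : ∀ i y y'', |hf i y - hf i y''| ≤ s / g.M * g.dist y y'')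
    (hcube : ∀ i y, pf i y ≠ 0 → js i ≤ g.scale y ∧ g.scale y ≤ js i + 1)
    (hlev : ∀ i y y', hf i y ≠ 0 → hf i y' ≠ 0 → g.scale y = g.scale y')
    (hgap : ∀ i y y'', pf i y = 0 → hf i y'' ≠ 0 → mg * g.M ≤ g.dist y y'')
    (hX : ∀ y y'', |g.len y'' ^ d * X y y''| ≤ BX * g.len y ^ p * Real.exp (-(1 / 2 * δ₀ * g.dist y y'')))
    (hXw : ∀ i y y'', |g.len y'' ^ d * Xw i y y''| ≤ BX * g.len y ^ p * Real.exp (-(1 / 2 * δ₀ * g.dist y y'')))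
    (hdom : ∀ i y y'', |pf i y * (g.len y'' ^ d * (Xw i y y'' - X y y'')) * hf i y''| ≤
      BD * Real.exp (-(c₃ * g.M)) * g.len y ^ p * Real.exp (-(1 / 2 * δ₀ * g.dist y y'')))
    (h2148 : ∀ i y y', pf i y ≠ 0 → pf i y' ≠ 0 →
      |Ck i y y'| ≤ BC / (g.L ^ js i * g.eta) ^ (d + p) * Real.exp (-(δ₁ * g.dist y y')))
    (hCk0 : ∀ i y'' y', pf i y'' = 0 → Ck i y'' y' = 0) (y y' : g.Site) :
    |mat (R282 (kerOp (fun z => g.len z ^ d) X) (fun i => mulOp (pf i))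
        (fun i => kerOp (fun z => g.len z ^ d) (Xw i)) (fun i => mulOp (hf i))
        (fun i => kerOp (fun z => g.len z ^ d) (Ck i))) y y'| ≤
      theta285P g d p n₀ s δ₀ cσ c₃ mg BX BD BC * Real.exp (-(δ₁ * g.dist y y')) := by
  have hc0 : 0 ≤ cσ := c_nonneg_of_ineq261With h261σ y
  have hL0 : 0 < g.L := zero_lt_one.trans_le hL
  have hεd : 0 ≤ kappa2P g d p s δ₀ cσ BX BC / g.M + kappa3P g d p cσ BD BC * Real.exp (-(c₃ * g.M)) := by
    unfold kappa2P kappa3P; positivity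
  have hεo : 0 ≤ kappa4P g d p cσ BX BC * Real.exp (-((1 / 8 * δ₀ * mg) * g.M)) := by
    unfold kappa4P; positivity
  have h := mat_R282_abs_le (kerOp (fun z => g.len z ^ d) X) (fun i => kerOp (fun z => g.len z ^ d) (Xw i))
    (fun i => kerOp (fun z => g.len z ^ d) (Ck i)) pf hf hover (E := fun y y' => Real.exp (-(δ₁ * g.dist y y')))
    (fun _ _ => (Real.exp_pos _).le) hεd hεo
    (fun i y y' => mat_diag_abs_le_pow d p htri hd hL hη hδ₀ hδ₁ hsplit h261σ hs hM hBX hBD hBC hpf01 hph hh1 hLip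
      hcube hXw hdom h2148 hCk0 i y y')
    (fun i i' hii y y' => mat_off_abs_le_pow d p htri hd hsep hL hη hδ₀ hδ₁ hsplit h261σ hRM hthr hBX hBC hpf01 hph
      hh1 hcube hlev hgap hX h2148 hii y y') y y'
  refine h.trans (le_of_eq ?_)
  simp only [theta285P]

omit [DecidableEq g.Site] [Fintype D] [DecidableEq D] in
/-- **θ = O(M⁻¹) at power p**: θ ≤ K/M with K = `K285P` (`B6Prop23Chain.theta_le_inv_M`).
[cite: Balaban1984PropagatorsII, (2.85) «O(M⁻¹)» p.238 + p.249] -/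
theorem theta285P_le (hM : 0 < g.M) {d p n₀ : ℕ} {s δ₀ cσ c₃ mg BX BD BC : ℝ} (hδ₀ : 0 < δ₀) (hc₃ : 0 < c₃)
    (hmg : 0 < mg) (hcσ : 0 ≤ cσ) (hBX : 0 ≤ BX) (hBD : 0 ≤ BD) (hBC : 0 ≤ BC) (hL : 0 ≤ g.L) :
    theta285P g d p n₀ s δ₀ cσ c₃ mg BX BD BC ≤ K285P g d p n₀ s δ₀ cσ c₃ mg BX BD BC / g.M := by
  unfold theta285P K285P
  exact theta_le_inv_M hM hc₃ (by positivity : 0 < 1 / 8 * δ₀ * mg) (by unfold kappa3P; positivity)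
    (by unfold kappa4P; positivity) (Nat.cast_nonneg n₀)

omit [Fintype D] [DecidableEq D] in
/-- **(2.87)/(2.149) LITERALLY, in the pairing (2.69), at power p.**  G(y, y′) = mat G y y′/(L^{j′}η)^d; if
|mat G y y′| ≤ K·((L^jη)^p)⁻¹·e^{−½δ₁d(y,y′)} then |G(y, y′)| ≤ K(L^jη)^{−p}(L^{j′}η)^{−d}e^{−½δ₁d(y,y′)} in the real-power
shape of `B6.Prop23Printed` (p = 4) and `B6.Prop27Printed` (p = 2) (p = 4: `B6Prop23Chain.kernel_bound_287`).
[cite: Balaban1984PropagatorsII, (2.87) p.238 + (2.149) p.249] -/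
theorem kernel_bound_pow (d p : ℕ) (hL : 0 < g.L) (hη : 0 < g.eta) {δ₁ K : ℝ} {G : Module.End ℝ (g.Site → ℝ)}
    (hG : ∀ y y', |mat G y y'| ≤ K * (g.len y ^ p)⁻¹ * Real.exp (-((1 - 1 / 2) * δ₁ * g.dist y y')))
    (y y' : g.Site) :
    |mat G y y' / g.len y' ^ d| ≤
      K * g.len y ^ (-(p : ℝ)) * g.len y' ^ (-(d : ℝ)) * Real.exp (-(δ₁ / 2 * g.dist y y')) := by
  have hlen : ∀ z : g.Site, 0 < g.len z := fun z => mul_pos (pow_pos hL _) hη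
  have hw : 0 < g.len y' ^ d := pow_pos (hlen y') d
  rw [abs_div, abs_of_pos hw, div_le_iff₀ hw, rpow_neg_natCast' (hlen y).le, rpow_neg_natCast' (hlen y').le]
  have h := hG y y'
  have hhalf : (1 - 1 / 2 : ℝ) * δ₁ * g.dist y y' = δ₁ / 2 * g.dist y y' := by ring
  rw [hhalf] at h
  calc |mat G y y'| ≤ K * (g.len y ^ p)⁻¹ * Real.exp (-(δ₁ / 2 * g.dist y y')) := h
    _ = K * (g.len y ^ p)⁻¹ * (g.len y' ^ d)⁻¹ * Real.exp (-(δ₁ / 2 * g.dist y y')) * g.len y' ^ d := by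
        field_simp

omit [Fintype D] [DecidableEq D] in
/-- **THE INVERSE WITH THE PRINTED KERNEL SHAPE AT POWER p** (`B6Prop23Chain.prop23_matrix` with P(y) = (L^jη)^{−p},
α = ½): X·C = 1 − R, |mat C| ≤ A(L^jη)^{−p}e^{−δ₁d}, |mat R| ≤ θe^{−δ₁d}, (2.61)/(2.63) at (δ₁, ½) with constant c, θc < 1
⟹ X has a unique two-sided inverse G = C + GR with |G(y, y′)| ≤ A c(1 − θc)⁻¹(L^jη)^{−p}(L^{j′}η)^{−d}e^{−½δ₁d(y,y′)}
(p = 4: `B6Prop23Chain.prop23_kernel_287`). [cite: Balaban1984PropagatorsII, (2.86)–(2.87) p.238 + (2.149) p.249] -/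
theorem inverse_kernel_pow (d p : ℕ) (hL : 0 < g.L) (hη : 0 < g.eta) (c δ₁ θ A : ℝ) (hA : 0 ≤ A) (hθ : 0 ≤ θ)
    (hc : 0 ≤ c) (hδ : 0 ≤ δ₁) (htri : Triangle254 g) (hrefl : ∀ y : g.Site, g.dist y y = 0)
    (hdnn : ∀ y y' : g.Site, 0 ≤ g.dist y y') (h261 : Ineq261With c g δ₁ (1 / 2))
    (h263 : Ineq263With c g δ₁ (1 / 2)) (hsmall : θ * c < 1) {X C R : Module.End ℝ (g.Site → ℝ)}
    (hXC : X * C = 1 - R)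
    (hC : ∀ y y', |mat C y y'| ≤ A * (g.len y ^ p)⁻¹ * Real.exp (-(δ₁ * g.dist y y')))
    (hR : ∀ y y', |mat R y y'| ≤ θ * Real.exp (-(δ₁ * g.dist y y'))) :
    ∃ G : Module.End ℝ (g.Site → ℝ), G * X = 1 ∧ X * G = 1 ∧ G = C + G * R ∧
      (∀ G' : Module.End ℝ (g.Site → ℝ), G' * X = 1 → G' = G) ∧
      ∀ y y', |mat G y y' / g.len y' ^ d| ≤
        A * c * (1 - θ * c)⁻¹ * g.len y ^ (-(p : ℝ)) * g.len y' ^ (-(d : ℝ)) *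
          Real.exp (-(δ₁ / 2 * g.dist y y')) := by
  have hαδ : 0 ≤ (1 - 1 / 2) * δ₁ := by positivity
  have hlen : ∀ z : g.Site, 0 < g.len z := fun z => mul_pos (pow_pos hL _) hη
  obtain ⟨G, hGX, hXG, hfix, huniq, hb⟩ :=
    prop23_matrix c δ₁ (1 / 2) θ A (fun y => (g.len y ^ p)⁻¹) hA
      (fun y => inv_nonneg.mpr (pow_nonneg (hlen y).le p)) hθ hc hαδ htri hrefl hdnn h261 h263 hsmall
      hXC hC hR
  exact ⟨G, hGX, hXG, hfix, huniq, fun y y' => kernel_bound_pow d p hL hη (fun y y' => hb y y') y y'⟩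

/-- **THE ASSEMBLED INVERSE AT POWER p** — the kernel twin of *"We form the equality for QGQ*C in exactly the same way
as in (2.82) … We have the same estimates now as before, but with powers of scaling factors changed properly (we replace
+4 and −4 in (2.83) by +2 and −2), thus we have (2.85) and this implies Proposition 2.7"* (p. 249), proved ONCE for every
power p: on the carrier 𝔅 = `g.Site` with the pairing (2.69), X = K_w(X) (Q′G′²Q′* for p = 4, QGQ* for p = 2), X̃_□
(Q′G′(□̃)²Q′* resp. QG_□Q*), C_□, h_□, □, C = Σ_□ h_□C_□h_□, R = Σ_{□,□′}R_{□,□′}C_{□′}h_{□′}; ASSUME the located cover facts,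
the kernel majorants of X, X̃_□ at the rate ½δ₀ with the scale factor (L^jη)^p, the change-of-domain majorant with its
factor e^{−c₃M}, the cube inverse bound B_C(L^{j_□}η)^{−d−p}e^{−δ₁d} on □ × □ ((2.81) resp. (2.148)), (□X̃_□□)C_□h_□ = h_□,
(2.54), (2.60), (2.61)/(2.63), L^p ≤ e^{⅛δ₀RM} and M ≥ 2Kc.  THEN X has a unique two-sided inverse G = C + GR and
|G(y, y′)| ≤ 2·n₀B_C L^{d+p}·c·(L^jη)^{−p}(L^{j′}η)^{−d}e^{−½δ₁d(y,y′)} (p = 4: `B6Prop23Assembled.prop23_assembled`, same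
constants by `K285P_four`). [cite: Balaban1984PropagatorsII, Prop. 2.3 (2.82)–(2.87) pp.237–238 + Prop. 2.7 (2.149) p.249] -/
theorem inverse_assembled_pow (d p : ℕ) (htri : Triangle254 g) (hrefl : ∀ y : g.Site, g.dist y y = 0)
    (hd : ∀ a b : g.Site, 0 ≤ g.dist a b) (hsep : LevelSep g) (hL : 1 ≤ g.L) (hη : 0 < g.eta)
    (hM : 0 < g.M) (hRM : 0 ≤ g.R * g.M)
    {δ₀ δ₁ σ cσ c c₃ s mg BX BD BC : ℝ} (hδ₀ : 0 < δ₀) (hδ₁ : 0 ≤ δ₁) (hsplit : δ₁ + σ * δ₀ ≤ δ₀ / 4)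
    (h261σ : Ineq261With cσ g δ₀ σ) (hthr : g.L ^ p ≤ Real.exp (1 / 8 * δ₀ * g.R * g.M))
    (h261 : Ineq261With c g δ₁ (1 / 2)) (h263 : Ineq263With c g δ₁ (1 / 2)) (hc : 0 ≤ c)
    (hc₃ : 0 < c₃) (hs : 0 ≤ s) (hmg : 0 < mg) (hBX : 0 ≤ BX) (hBD : 0 ≤ BD) (hBC : 0 ≤ BC)
    {pf hf : D → g.Site → ℝ} {js : D → ℕ} {n₀ : ℕ} {X : g.Site → g.Site → ℝ}
    {Xw Ck : D → g.Site → g.Site → ℝ}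
    (hover : ∀ y, (Finset.univ.filter fun i => hf i y ≠ 0).card ≤ n₀)
    (hpf01 : ∀ i y, pf i y = 0 ∨ pf i y = 1) (hph : ∀ i y, pf i y * hf i y = hf i y)
    (h236 : ∀ y, ∑ i, hf i y ^ 2 = 1) (hLip : ∀ i y y'', |hf i y - hf i y''| ≤ s / g.M * g.dist y y'')
    (hcube : ∀ i y, pf i y ≠ 0 → js i ≤ g.scale y ∧ g.scale y ≤ js i + 1)
    (hlev : ∀ i y y', hf i y ≠ 0 → hf i y' ≠ 0 → g.scale y = g.scale y')
    (hgap : ∀ i y y'', pf i y = 0 → hf i y'' ≠ 0 → mg * g.M ≤ g.dist y y'')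
    (hX : ∀ y y'', |g.len y'' ^ d * X y y''| ≤ BX * g.len y ^ p * Real.exp (-(1 / 2 * δ₀ * g.dist y y'')))
    (hXw : ∀ i y y'', |g.len y'' ^ d * Xw i y y''| ≤ BX * g.len y ^ p * Real.exp (-(1 / 2 * δ₀ * g.dist y y'')))
    (hdom : ∀ i y y'', |pf i y * (g.len y'' ^ d * (Xw i y y'' - X y y'')) * hf i y''| ≤
      BD * Real.exp (-(c₃ * g.M)) * g.len y ^ p * Real.exp (-(1 / 2 * δ₀ * g.dist y y'')))
    (h2148 : ∀ i y y', pf i y ≠ 0 → pf i y' ≠ 0 →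
      |Ck i y y'| ≤ BC / (g.L ^ js i * g.eta) ^ (d + p) * Real.exp (-(δ₁ * g.dist y y')))
    (hCk0 : ∀ i y'' y', pf i y'' = 0 → Ck i y'' y' = 0)
    (h270 : ∀ i, locOp (fun i => mulOp (pf i)) (fun i => kerOp (fun z => g.len z ^ d) (Xw i)) i *
      kerOp (fun z => g.len z ^ d) (Ck i) * mulOp (hf i) = mulOp (hf i))
    (hKM : 2 * K285P g d p n₀ s δ₀ cσ c₃ mg BX BD BC * c ≤ g.M) :
    ∃ G : Module.End ℝ (g.Site → ℝ),
      G * kerOp (fun z => g.len z ^ d) X = 1 ∧ kerOp (fun z => g.len z ^ d) X * G = 1 ∧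
      G = Cglued (fun i => mulOp (hf i)) (fun i => kerOp (fun z => g.len z ^ d) (Ck i)) +
        G * R282 (kerOp (fun z => g.len z ^ d) X) (fun i => mulOp (pf i))
          (fun i => kerOp (fun z => g.len z ^ d) (Xw i)) (fun i => mulOp (hf i))
          (fun i => kerOp (fun z => g.len z ^ d) (Ck i)) ∧
      (∀ G' : Module.End ℝ (g.Site → ℝ), G' * kerOp (fun z => g.len z ^ d) X = 1 → G' = G) ∧
      ∀ y y', |mat G y y' / g.len y' ^ d| ≤
        2 * (n₀ * (BC * g.L ^ (d + p))) * c * g.len y ^ (-(p : ℝ)) * g.len y' ^ (-(d : ℝ)) *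
          Real.exp (-(δ₁ / 2 * g.dist y y')) := by
  rcases isEmpty_or_nonempty g.Site with he | hne
  · exact ⟨0, Subsingleton.elim _ _, Subsingleton.elim _ _, Subsingleton.elim _ _, fun G' _ => Subsingleton.elim _ _,
      fun y _ => (he.false y).elim⟩
  obtain ⟨y₀⟩ := hne
  have hcσ : 0 ≤ cσ := c_nonneg_of_ineq261With h261σ y₀
  have hL0 : 0 < g.L := zero_lt_one.trans_le hL
  have hlen : ∀ z : g.Site, 0 < g.len z := fun z => mul_pos (pow_pos hL0 _) hη
  have hh1 : ∀ i y, |hf i y| ≤ 1 := abs_hf_le_one h236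
  -- the (2.82)-type equality X·C = 1 − R
  have hphOp : ∀ i, mulOp (pf i) * mulOp (hf i) = mulOp (hf i) := by
    intro i
    rw [mulOp_mul_mulOp]
    exact congrArg mulOp (funext fun y => hph i y)
  have hXC := expansion282 (kerOp (fun z => g.len z ^ d) X) (p := fun i => mulOp (pf i))
    (t := fun i => kerOp (fun z => g.len z ^ d) (Xw i)) (h := fun i => mulOp (hf i))
    (c := fun i => kerOp (fun z => g.len z ^ d) (Ck i)) hphOp (partitionSq_mulOp hf h236) h270
  -- (2.85) with θ explicit, θ ≤ K/M, «M large enough»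
  set θ : ℝ := theta285P g d p n₀ s δ₀ cσ c₃ mg BX BD BC with hθdef
  have hθ0 : 0 ≤ θ := by
    rw [hθdef]; unfold theta285P kappa2P kappa3P kappa4P; positivity
  have hR : ∀ y y', |mat (R282 (kerOp (fun z => g.len z ^ d) X) (fun i => mulOp (pf i))
      (fun i => kerOp (fun z => g.len z ^ d) (Xw i)) (fun i => mulOp (hf i))
      (fun i => kerOp (fun z => g.len z ^ d) (Ck i))) y y'| ≤ θ * Real.exp (-(δ₁ * g.dist y y')) :=
    fun y y' => mat_R_abs_le_pow d p htri hd hsep hL hη hM hRM hδ₀ hδ₁ hsplit h261σ hthr hs hBX hBD hBC hover hpf01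
      hph hh1 hLip hcube hlev hgap hX hXw hdom h2148 hCk0 y y'
  have hθK : θ ≤ K285P g d p n₀ s δ₀ cσ c₃ mg BX BD BC / g.M :=
    theta285P_le hM hδ₀ hc₃ hmg hcσ hBX hBD hBC hL0.le
  obtain ⟨-, hsmall, hinv2⟩ := smallness_of_M_large hM hc hθK hKM
  -- the C-majorant from the glued cube inverses
  have hscH : ∀ i y, hf i y ≠ 0 → g.scale y ≤ js i + 1 :=
    fun i y h => (hcube i y (pf_ne_zero_of_hf_ne_zero hph h)).2
  have h2148H : ∀ i y y', hf i y ≠ 0 → hf i y' ≠ 0 →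
      |Ck i y y'| ≤ BC / (g.L ^ js i * g.eta) ^ (d + p) * Real.exp (-(δ₁ * g.dist y y')) :=
    fun i y y' hy hy' => h2148 i y y' (pf_ne_zero_of_hf_ne_zero hph hy) (pf_ne_zero_of_hf_ne_zero hph hy')
  have hC := mat_Cglued_abs_le_pow d p hL hη hf Ck js hover hh1 hscH hBC h2148H
  set A : ℝ := n₀ * (BC * g.L ^ (d + p)) with hAdef
  have hA : 0 ≤ A := by positivity
  obtain ⟨G, hGX, hXG, hfix, huniq, hb⟩ := inverse_kernel_pow d p hL0 hη c δ₁ θ A hA hθ0 hc hδ₁ htri hrefl hd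
    h261 h263 hsmall hXC (fun y y' => hC y y') hR
  refine ⟨G, hGX, hXG, hfix, huniq, fun y y' => (hb y y').trans ?_⟩
  have hP : 0 ≤ g.len y ^ (-(p : ℝ)) * g.len y' ^ (-(d : ℝ)) * Real.exp (-(δ₁ / 2 * g.dist y y')) := by
    have := (hlen y).le; have := (hlen y').le; positivity
  calc A * c * (1 - θ * c)⁻¹ * g.len y ^ (-(p : ℝ)) * g.len y' ^ (-(d : ℝ)) * Real.exp (-(δ₁ / 2 * g.dist y y'))
      = (1 - θ * c)⁻¹ * (A * c) *
          (g.len y ^ (-(p : ℝ)) * g.len y' ^ (-(d : ℝ)) * Real.exp (-(δ₁ / 2 * g.dist y y'))) := by ring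
    _ ≤ 2 * (A * c) * (g.len y ^ (-(p : ℝ)) * g.len y' ^ (-(d : ℝ)) * Real.exp (-(δ₁ / 2 * g.dist y y'))) :=
        mul_le_mul_of_nonneg_right (mul_le_mul_of_nonneg_right hinv2 (mul_nonneg hA hc)) hP
    _ = 2 * A * c * g.len y ^ (-(p : ℝ)) * g.len y' ^ (-(d : ℝ)) * Real.exp (-(δ₁ / 2 * g.dist y y')) := by
        ring

end Assembly

/-! ## §7. The edge p = 2: the assembled inverse of QGQ* ⟹ `B6.Prop27Printed` (Proposition 2.7, (2.149)) -/

section Edge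

/-- **THE EDGE `inverse_assembled_pow` (p = 2) ⟹ `B6.Prop27Printed` — PROPOSITION 2.7 BY ITS PRINTED PROOF.**  For a
family of situations `geo : I → B6.Geometry` (bonds of 𝔅 as sites, pairing (2.69) «with sites replaced by bonds») with
cube data (□ = `pf i`, h_□ = `hf i`, cube scales `js i`), kernels X_i = QGQ* with *"|(QGQ*)(b,b′)| ≤
O(1)(L^jη)²(L^{j′}η)^{−d}e^{−δ₃d(b,b′)}"* (2.142) (rate written ½δ₀, δ₀ a free rate name), X̃_{i,□} = QG_□Q*, C_{i,□} =
((QG_□Q*)↾_□)⁻¹ with *"|C_□(b,b′)| ≤ O(1)(L^jη)^{−d−2}e^{−δ₄(L^jη)^{−1}|b₋−b′₋|}, b,b′ ∈ 𝔅∩□"* (2.148) (as the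
d-metric bound B_C(L^{j_□}η)^{−d−2}e^{−δ₄d(b,b′)} on □ × □ — inside one cube the straight contour is admissible), the
located inputs of `inverse_assembled_pow` at p = 2 for every i with UNIFORM constants, a common threshold
M₁ ≥ 2K_i c (*"for M large enough"*, K = `K285P … 2`), L_i² ≤ e^{⅛δ₀R_iM_i} above the threshold, a common constant
C ≥ 2n₀B_C L_i^{d+2}c, and the dictionary "`Qinv i` is the (2.69)-kernel of an inverse of X_i whenever M₁ ≤ M_i":
the printed Proposition 2.7 in the verbatim typing of `…B6`, *"|(QGQ*)⁻¹(b,b′)| ≤ O(1)(L^jη)^{−2}(L^{j′}η)^{−d}e^{−½δ₄d(b,b′)},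
b∈Λ_j, b′∈Λ_{j′}"* (2.149), witnesses (M₁, δ₄, C).  Proof: uniqueness of the inverse and monotonicity in the constant.
[cite: Balaban1984PropagatorsII, Prop. 2.7, (2.142)–(2.143) p.248, (2.148)–(2.149) p.249] -/
theorem prop27Printed_of_assembled {I : Type} (d : ℕ) (geo : I → B6.Geometry) [∀ i, DecidableEq (geo i).Site]
    (Qinv : ∀ i, B6.SiteKernel (geo i))
    (htri : ∀ i, Triangle254 (geo i)) (hrefl : ∀ i (y : (geo i).Site), (geo i).dist y y = 0)
    (hd : ∀ i (a b : (geo i).Site), 0 ≤ (geo i).dist a b) (hsep : ∀ i, LevelSep (geo i))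
    (hL : ∀ i, 1 ≤ (geo i).L) (hη : ∀ i, 0 < (geo i).eta) (hM : ∀ i, 0 < (geo i).M)
    (hRM : ∀ i, 0 ≤ (geo i).R * (geo i).M)
    {δ₀ δ₄ σ cσ c c₃ s mg BX BD BC M₁ C : ℝ} {n₀ : ℕ}
    (hδ₀ : 0 < δ₀) (hδ₄ : 0 < δ₄) (hsplit : δ₄ + σ * δ₀ ≤ δ₀ / 4)
    (h261σ : ∀ i, Ineq261With cσ (geo i) δ₀ σ)
    (hthr : ∀ i, M₁ ≤ (geo i).M → (geo i).L ^ 2 ≤ Real.exp (1 / 8 * δ₀ * (geo i).R * (geo i).M))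
    (h261 : ∀ i, Ineq261With c (geo i) δ₄ (1 / 2)) (h263 : ∀ i, Ineq263With c (geo i) δ₄ (1 / 2)) (hc : 0 ≤ c)
    (hc₃ : 0 < c₃) (hs : 0 ≤ s) (hmg : 0 < mg) (hBX : 0 ≤ BX) (hBD : 0 ≤ BD) (hBC : 0 ≤ BC)
    (hM₁ : 0 < M₁) (hC : 0 < C)
    (hKM : ∀ i, 2 * K285P (geo i) d 2 n₀ s δ₀ cσ c₃ mg BX BD BC * c ≤ M₁)
    (hCB : ∀ i, 2 * (n₀ * (BC * (geo i).L ^ (d + 2))) * c ≤ C)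
    {D : I → Type} [∀ i, Fintype (D i)] [∀ i, DecidableEq (D i)]
    {pf hf : ∀ i, D i → (geo i).Site → ℝ} {js : ∀ i, D i → ℕ} {X : ∀ i, (geo i).Site → (geo i).Site → ℝ}
    {Xw Ck : ∀ i, D i → (geo i).Site → (geo i).Site → ℝ}
    (hover : ∀ i y, (Finset.univ.filter fun a => hf i a y ≠ 0).card ≤ n₀)
    (hpf01 : ∀ i a y, pf i a y = 0 ∨ pf i a y = 1) (hph : ∀ i a y, pf i a y * hf i a y = hf i a y)
    (h236 : ∀ i y, ∑ a, hf i a y ^ 2 = 1)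
    (hLip : ∀ i a y y'', |hf i a y - hf i a y''| ≤ s / (geo i).M * (geo i).dist y y'')
    (hcube : ∀ i a y, pf i a y ≠ 0 → js i a ≤ (geo i).scale y ∧ (geo i).scale y ≤ js i a + 1)
    (hlev : ∀ i a y y', hf i a y ≠ 0 → hf i a y' ≠ 0 → (geo i).scale y = (geo i).scale y')
    (hgap : ∀ i a y y'', pf i a y = 0 → hf i a y'' ≠ 0 → mg * (geo i).M ≤ (geo i).dist y y'')
    (hX : ∀ i y y'', |(geo i).len y'' ^ d * X i y y''| ≤
      BX * (geo i).len y ^ 2 * Real.exp (-(1 / 2 * δ₀ * (geo i).dist y y'')))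
    (hXw : ∀ i a y y'', |(geo i).len y'' ^ d * Xw i a y y''| ≤
      BX * (geo i).len y ^ 2 * Real.exp (-(1 / 2 * δ₀ * (geo i).dist y y'')))
    (hdom : ∀ i a y y'', |pf i a y * ((geo i).len y'' ^ d * (Xw i a y y'' - X i y y'')) * hf i a y''| ≤
      BD * Real.exp (-(c₃ * (geo i).M)) * (geo i).len y ^ 2 * Real.exp (-(1 / 2 * δ₀ * (geo i).dist y y'')))
    (h2148 : ∀ i a y y', pf i a y ≠ 0 → pf i a y' ≠ 0 →
      |Ck i a y y'| ≤ BC / ((geo i).L ^ js i a * (geo i).eta) ^ (d + 2) * Real.exp (-(δ₄ * (geo i).dist y y')))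
    (hCk0 : ∀ i a y'' y', pf i a y'' = 0 → Ck i a y'' y' = 0)
    (h270 : ∀ i a, locOp (fun a => mulOp (pf i a)) (fun a => kerOp (fun z => (geo i).len z ^ d) (Xw i a)) a *
      kerOp (fun z => (geo i).len z ^ d) (Ck i a) * mulOp (hf i a) = mulOp (hf i a))
    (hinv : ∀ i, M₁ ≤ (geo i).M → ∃ G : Module.End ℝ ((geo i).Site → ℝ),
      G * kerOp (fun z => (geo i).len z ^ d) (X i) = 1 ∧
        ∀ y y', (Qinv i).ker y y' = mat G y y' / (geo i).len y' ^ d) :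
    B6.Prop27Printed d geo Qinv := by
  refine ⟨M₁, δ₄, C, hM₁, hδ₄, hC, fun i _ hMi y y' => ?_⟩
  obtain ⟨G, -, -, -, huniq, hb⟩ := inverse_assembled_pow (g := geo i) d 2 (htri i) (hrefl i) (hd i) (hsep i)
    (hL i) (hη i) (hM i) (hRM i) hδ₀ hδ₄.le hsplit (h261σ i) (hthr i hMi) (h261 i) (h263 i) hc hc₃ hs hmg hBX hBD
    hBC (hover i) (hpf01 i) (hph i) (h236 i) (hLip i) (hcube i) (hlev i) (hgap i) (hX i) (hXw i) (hdom i)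
    (h2148 i) (hCk0 i) (h270 i) ((hKM i).trans hMi)
  obtain ⟨G', hG'X, hker⟩ := hinv i hMi
  rw [hker y y', huniq G' hG'X]
  refine (hb y y').trans ?_
  have hL0 : 0 < (geo i).L := zero_lt_one.trans_le (hL i)
  have hlen : ∀ z : (geo i).Site, 0 < (geo i).len z := fun z => mul_pos (pow_pos hL0 _) (hη i)
  have h2 : ((2 : ℕ) : ℝ) = (2 : ℝ) := by norm_num
  rw [h2]
  exact mul_le_mul_of_nonneg_right (mul_le_mul_of_nonneg_right (mul_le_mul_of_nonneg_right (hCB i)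
    (Real.rpow_nonneg (hlen y).le _)) (Real.rpow_nonneg (hlen y').le _)) (Real.exp_pos _).le

end Edge

/-! ## §8. Consistency of the hypothesis package at p = 2: the one-point, one-cube model -/

section NonVacuity

/-- The constant K of θ ≤ K/M at power p on the one-point model `B6Prop23Assembled.ptGeo` is 1/e. [folklore] -/
theorem ptGeo_K285P (d p : ℕ) : K285P ptGeo d p 1 0 8 1 1 1 1 0 1 = 1 / Real.exp 1 := by
  unfold K285P kappa2P kappa3P kappa4P
  norm_num

/-- «M large enough» at power p on the one-point model: 2K·c = 2/e ≤ 1 = M. [folklore] -/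
theorem ptGeo_thresholdP (d p : ℕ) : 2 * K285P ptGeo d p 1 0 8 1 1 1 1 0 1 * 1 ≤ ptGeo.M := by
  have h2e : (2 : ℝ) ≤ Real.exp 1 := by
    have := Real.add_one_le_exp (1 : ℝ); norm_num at this ⊢; linarith
  have he : 0 < Real.exp 1 := Real.exp_pos 1
  rw [ptGeo_K285P, ptGeo_M, mul_one, mul_one_div, div_le_iff₀ he]
  linarith

/-- **NON-VACUITY OF THE EDGE `prop27Printed_of_assembled`**: on the one-point family (one situation
`B6Prop23Assembled.ptGeo`, one cube, □ = h_□ = 1, unit kernels X = X̃_□ = C_□, δ₀ = 8, δ₄ = 1, σ = s = B_D = 0,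
c_σ = c = c₃ = m_g = B_X = B_C = 1, n₀ = 1, M₁ = 1, C = 2, Qinv = the unit kernel = the (2.69)-kernel of the inverse 1 of
X = 1) every hypothesis of the edge is discharged — the term below is the theorem applied there — so `B6.Prop27Printed`
holds on that family by this route and the hypothesis package is not contradictory. [folklore] -/
theorem prop27Printed_pt (d : ℕ) :
    B6.Prop27Printed d (fun _ : Unit => ptGeo) (fun _ => ⟨fun _ _ => (1 : ℝ)⟩) :=
  prop27Printed_of_assembled (geo := fun _ : Unit => ptGeo) d _ (δ₀ := 8) (δ₄ := 1) (σ := 0) (cσ := 1) (c := 1)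
    (c₃ := 1) (s := 0) (mg := 1) (BX := 1) (BD := 0) (BC := 1) (M₁ := 1) (C := 2) (n₀ := 1) (D := fun _ => Unit)
    (pf := fun _ _ _ => 1) (hf := fun _ _ _ => 1) (js := fun _ _ => 0) (X := fun _ _ _ => 1) (Xw := fun _ _ _ _ => 1)
    (Ck := fun _ _ _ _ => 1)
    (fun _ _ _ _ => by simp) (fun _ _ => rfl) (fun _ _ _ => le_rfl)
    (fun _ y y' => by show (0 : ℝ) * 1 * mx ptGeo y y' ≤ 0; simp) (fun _ => le_rfl) (fun _ => one_pos)
    (fun _ => one_pos) (fun _ => by show (0 : ℝ) ≤ 0 * 1; norm_num) (by norm_num) one_pos (by norm_num)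
    (fun _ _ => by simp) (fun _ _ => by simp) (fun _ _ => by simp)
    (fun _ m y y' => by rw [ptGeo_chain_rate]; simp) zero_le_one one_pos le_rfl one_pos zero_le_one le_rfl
    zero_le_one one_pos two_pos (fun _ => ptGeo_thresholdP d 2) (fun _ => by norm_num)
    (fun _ _ => (Finset.card_filter_le _ _).trans (by simp)) (fun _ _ _ => Or.inr rfl) (fun _ _ _ => one_mul _)
    (fun _ _ => by simp) (fun _ _ _ _ => by simp) (fun _ _ _ _ => ⟨le_rfl, by simp⟩) (fun _ _ _ _ _ _ => rfl)
    (fun _ _ _ _ h _ => absurd h one_ne_zero) (fun _ _ _ => by simp) (fun _ _ _ _ => by simp)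
    (fun _ _ _ _ => by simp) (fun _ _ _ _ _ _ => by simp) (fun _ _ _ _ h => absurd h one_ne_zero)
    (fun _ _ => LinearMap.ext fun μ => funext fun y => by cases y; simp [locOp])
    (fun _ _ => ⟨1, by rw [one_mul]; exact LinearMap.ext fun μ => funext fun y => by cases y; simp,
      fun y y' => by cases y; cases y'; simp [mat]⟩)

end NonVacuity

end Literature.MathematicalPhysics.QuantumFieldTheory.Balaban1983to89.B6Prop27Kernel
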